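import Mathlib.Algebra.Field.ZMod
import Mathlib.LinearAlgebra.Matrix.Permutation
import Literature.Computability.AlgebraicComplexity.FlipGraphLadermanIsolatedKM
import HarnessLib

/-!
# The standard algorithm has exactly one neighbour in the flip graph (KM 2023, §4), over `ℤ₂`

Topic `Literature/Computability/AlgebraicComplexity`, over the flip-graph vocabulary of
`FlipGraphConnectivity.lean` (KM Def. 1 `Scheme`, Def. 4 `Flips`/`FlipBase`, Prop. 3
`Reduces`/`RedBase`, Def. 8 `Adj`, the standard scheme `stdScheme`), `FlipGraphSymmetry.lean` /
`FlipGraphEquivariance.lean` (KM's symmetry group `InSymmetryGroup` generated by the sandwiches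
`Symmetry.sandwich`, the cyclic shift `Symmetry.cycleSq` and the transposition; the orbit relation
`orbitSetoidKM`, KM's graph on orbits `flipGraphKM`) and `FlipGraphLadermanIsolatedKM.lean`
(`fam`, `triad_factors_eq_of_two`: over `ℤ₂` a non-zero rank-one tensor determines its factors).
Source: M. Kauers, J. Moosbauer, *Flip Graphs for Matrix Multiplication*, ISSAC 2023 =
arXiv:2212.01175 (KM), §4 (`K = ℤ₂`): for `(2,2,2)`, "Although the standard algorithm allows many
flips, it only has one neighbor, because any two schemes obtained by a flip from the standard
algorithm are equivalent."; for `(3,3,3)`, "Again, and for the same reason as before, the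
standard algorithm itself has only one neighbor."  Everything here is PROVED; no named facts.

## What is typed

* §1 (any field with only the scalars `0, 1`, i.e. `ℤ₂`; any finite index types): **which
  multisets are flips of a given scheme** — for a scheme presented by an injective family
  `s ↦ w_s ⊗ u_s ⊗ v_s` of non-zero rank-one tensors, if `S'` is a flip of it in the written case
  of Def. 4 then `S'` is the family with two members `i ≠ j`, `w_i = w_j`, replaced by
  `w_i ⊗ u_i ⊗ (v_i + v_j)`, `w_j ⊗ (u_j − u_i) ⊗ v_j` or by `w_i ⊗ (u_i + u_j) ⊗ v_i`,
  `w_j ⊗ u_j ⊗ (v_j − v_i)` (`exists_update_of_flipBase`; all three slots: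
  `exists_update_of_flips`; converses `flipBase_fam_update₁/₂`, any field); and **no reduction
  applies** when equal first factors force "separated" second factors (`not_redBase_fam_of_sep`,
  `not_reduces_fam_of_sep` — the situation of the standard algorithm).
* §2 (any field, any `n`): the **permutation sandwiches** `(P_π, P_σ, P_ρ) ∈ G` relabel the indices
  of every rank-one tensor (`relabelSym`, `relabelSym_triad`). §2b: the property "some element has,
  in some slot, a factor shared with no other element" (`Lonely`) is invariant under KM's group
  (`InSymmetryGroup.exists_slotPerm`, `Lonely.map`, `lonely_iff_of_equiv`) and is read off the
  factors over `ℤ₂` (`LonelyFam`, `lonely_of_lonelyFam`, `lonelyFam_of_lonely`).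
* §3–§4 (`K = ℤ₂`, `n = 2` and `n = 3`): every flip of the standard algorithm is one of the
  explicit candidates `candFam (s, i, j)` (shared slot `s`, positions `i ≠ j`; the second choice
  of `T` on `(i, j)` is the first on `(j, i)` over `ℤ₂`): `24` for `n = 2`, `162` for `n = 3`
  (`exists_cand_of_flips`, `flips_of_cand`); each is the image of ONE of them, `N₀`, under an
  explicit element of `G` — a permutation sandwich followed by a power of the cyclic shift, given
  by the tables `witTab₂`, `witTab₃_0/1/2` and checked by the kernel member by member along the
  induced index bijection (`Checks.key`, `tms_eq_of_pointwise`) —, and the standard algorithm is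
  irreducible; hence, from the finitely many `Checks` (`checks₂`, `checks₃`, kernel evaluation):
  **`kauersMoosbauer2023_std_neighbours_equivalent₂/₃`** — any two neighbours (Def. 8: flips or
  reductions) of the standard algorithm of `⟨2,2,2⟩`, resp. `⟨3,3,3⟩`, over `ℤ₂` are equivalent
  under KM's symmetry group; `N₀` is a neighbour (`flips_std_N₀`, `adj_std_N₀`, rank `n³`:
  `rank_N₀`); in KM's flip graph on orbits the orbit of the standard algorithm has exactly one
  out-neighbour (**`kauersMoosbauer2023_std_one_neighbour₂/₃`**: `flipGraphKM ⟦std⟧ q ↔ q = ⟦N₀⟧`),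
  and it is not the orbit of the standard algorithm itself
  (**`kauersMoosbauer2023_std_neighbour_ne₂/₃`**, via `N₀_not_equiv_std`: the standard algorithm
  has no lonely factor, `N₀` has one — `lonelyFacts₂/₃`).

HONEST FRAMING: KM's sentence is about `K = ℤ₂` and the formats `(2,2,2)`, `(3,3,3)`; that is what
is typed (the structural reason — relabelings and the cyclic symmetry act transitively on the flips
of the standard algorithm — holds for every `n`, but the transitivity is kernel-checked here only
for `n = 2, 3`, from witness tables found by a search of ours). "Neighbour" = out-neighbour along
`E₁ ∪ E₂` (Def. 8). Equivalence is under KM's group `G` (`InSymmetryGroup`: sandwiches, cyclic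
shift, transposition); only sandwiches and the cyclic shift are used for the upper bound.

## References

* M. Kauers, J. Moosbauer, *Flip Graphs for Matrix Multiplication*, ISSAC 2023, 381–388,
  doi:10.1145/3597066.3597120, arXiv:2212.01175: §4 (the two "one neighbor" sentences), Def. 2,
  Prop. 3, Def. 4, Def. 8, §2 (symmetry group). [KauersMoosbauer2022FlipGraphs]
* H. F. de Groote, *On varieties of optimal algorithms for the computation of bilinear mappings.
  I*, Theoret. Comput. Sci. 7 (1978) 1–24, §3 (sandwich symmetries). [Degroote1978]
* M. J. H. Heule, M. Kauers, M. Seidl, *New ways to multiply 3 × 3-matrices*, J. Symbolic Comput.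
  104 (2021) 899–916, arXiv:1905.10192, §4 (orbit invariants used to recognise inequivalent
  schemes). [HeuleKauersSeidl2021]
-/

namespace Literature.Computability.AlgebraicComplexity

open scoped BigOperators Kronecker
open Multiset Matrix

namespace FlipGraph

/-! ## §1 Flips and reductions of a scheme presented by an injective family, over `ℤ₂` -/

section FamFlips

variable {K : Type*} [Field K] {ι κ μ : Type*} {σ : Type*} [Fintype σ] [DecidableEq σ]
variable {w : σ → ι → K} {u : σ → κ → K} {v : σ → μ → K}

/-- `a ⊗ b ⊗ (c + c') = a ⊗ b ⊗ c + a ⊗ b ⊗ c'`. [folklore] -/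
private theorem triad_add₃ (a : ι → K) (b : κ → K) (c c' : μ → K) :
    triad a b (c + c') = triad a b c + triad a b c' := by
  funext x y z; simp only [triad_apply, Pi.add_apply]; ring

/-- `a ⊗ (b + b') ⊗ c = a ⊗ b ⊗ c + a ⊗ b' ⊗ c`. [folklore] -/
private theorem triad_add₂ (a : ι → K) (b b' : κ → K) (c : μ → K) :
    triad a (b + b') c = triad a b c + triad a b' c := by
  funext x y z; simp only [triad_apply, Pi.add_apply]; ring

/-- `a ⊗ b ⊗ (c − c') = a ⊗ b ⊗ c − a ⊗ b ⊗ c'`. [folklore] -/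
private theorem triad_sub₃ (a : ι → K) (b : κ → K) (c c' : μ → K) :
    triad a b (c - c') = triad a b c - triad a b c' := by
  funext x y z; simp only [triad_apply, Pi.sub_apply]; ring

/-- `a ⊗ (b − b') ⊗ c = a ⊗ b ⊗ c − a ⊗ b' ⊗ c`. [folklore] -/
private theorem triad_sub₂ (a : ι → K) (b b' : κ → K) (c : μ → K) :
    triad a (b - b') c = triad a b c - triad a b' c := by
  funext x y z; simp only [triad_apply, Pi.sub_apply]; ring

/-- The family split at two positions `i ≠ j`:
`{T_s}_s = T_i :: T_j :: {T_s}_{s ≠ i,j}`. [folklore] -/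
private theorem univ_val_eq_cons_cons {i j : σ} (hij : i ≠ j) :
    (Finset.univ : Finset σ).val = i ::ₘ j ::ₘ ((Finset.univ.erase i).erase j).val := by
  have hj : j ∈ Finset.univ.erase i := Finset.mem_erase.2 ⟨hij.symm, Finset.mem_univ j⟩
  have h1 : (Finset.univ : Finset σ) = insert i (Finset.univ.erase i) :=
    (Finset.insert_erase (Finset.mem_univ i)).symm
  have h2 : (Finset.univ : Finset σ).erase i = insert j ((Finset.univ.erase i).erase j) :=
    (Finset.insert_erase hj).symm
  have hi' : i ∉ insert j ((Finset.univ.erase i).erase j) := by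
    rw [← h2]; exact Finset.notMem_erase i _
  have hj' : j ∉ (Finset.univ.erase i).erase j := Finset.notMem_erase j _
  conv_lhs => rw [h1, h2]
  rw [Finset.insert_val_of_notMem hi', Finset.insert_val_of_notMem hj']

/-- A family agreeing with `s ↦ w_s ⊗ u_s ⊗ v_s` outside `{i, j}` presents the multiset
`T'_i :: T'_j :: {w_s ⊗ u_s ⊗ v_s}_{s ≠ i, j}`. [folklore] -/
private theorem fam_eq_cons_cons_of_agree {i j : σ} (hij : i ≠ j) (w' : σ → ι → K) (u' : σ → κ → K)
    (v' : σ → μ → K)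
    (h : ∀ s, s ≠ i → s ≠ j → triad (w' s) (u' s) (v' s) = triad (w s) (u s) (v s)) :
    fam w' u' v' = triad (w' i) (u' i) (v' i) ::ₘ triad (w' j) (u' j) (v' j) ::ₘ
      ((Finset.univ.erase i).erase j).val.map fun s => triad (w s) (u s) (v s) := by
  rw [fam, univ_val_eq_cons_cons hij, Multiset.map_cons, Multiset.map_cons]
  congr 2
  refine Multiset.map_congr rfl fun s hs => ?_
  have hs' : s ∈ (Finset.univ.erase i).erase j := hs
  rw [Finset.mem_erase, Finset.mem_erase] at hs'
  exact h s hs'.2.1 hs'.1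

/-- The family itself so split. [folklore] -/
private theorem fam_eq_cons_cons {i j : σ} (hij : i ≠ j) :
    fam w u v = triad (w i) (u i) (v i) ::ₘ triad (w j) (u j) (v j) ::ₘ
      ((Finset.univ.erase i).erase j).val.map fun s => triad (w s) (u s) (v s) :=
  fam_eq_cons_cons_of_agree hij w u v fun _ _ _ => rfl

/-- An injective family presents a multiset without repetitions. [folklore] -/
private theorem nodup_fam_of_inj
    (hnd : ∀ s s', s ≠ s' → triad (w s) (u s) (v s) ≠ triad (w s') (u s') (v s')) :
    (fam w u v).Nodup :=
  Multiset.Nodup.map (fun s s' h => by by_contra hne; exact hnd s s' hne h) Finset.univ.nodup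

/-- **Which multisets are flips of an injectively presented scheme over `ℤ₂` (Def. 4, the written
case, shared first factor):** if `S'` is such a flip of `{w_s ⊗ u_s ⊗ v_s}_s` (non-zero, pairwise
distinct rank-one tensors; all scalars `0` or `1`), then for some `i ≠ j` with `w_i = w_j` the
multiset `S'` is the family with `u_j, v_i` replaced by `u_j − u_i, v_i + v_j`, or with `u_i, v_j`
replaced by `u_i + u_j, v_j − v_i` (the two choices of `T` in Def. 4).
[cite: KauersMoosbauer2022FlipGraphs, Def. 4 (with §4, `K = ℤ₂`)] -/
theorem exists_update_of_flipBase (hK : ∀ x : K, x = 0 ∨ x = 1)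
    (h0 : ∀ s, triad (w s) (u s) (v s) ≠ 0)
    (hnd : ∀ s s', s ≠ s' → triad (w s) (u s) (v s) ≠ triad (w s') (u s') (v s'))
    {S' : Multiset (ι → κ → μ → K)} (h : FlipBase (fam w u v) S') :
    ∃ i j, i ≠ j ∧ w i = w j ∧
      (S' = fam w (Function.update u j (u j - u i)) (Function.update v i (v i + v j)) ∨
       S' = fam w (Function.update u i (u i + u j)) (Function.update v j (v j - v i))) := by
  obtain ⟨a, b, b', c, c', R, hS, hS'⟩ := h
  have h₁ : triad a b c ∈ fam w u v := by rw [hS]; exact Multiset.mem_cons_self _ _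
  have h₂ : triad a b' c' ∈ fam w u v := by
    rw [hS]; exact Multiset.mem_cons_of_mem (Multiset.mem_cons_self _ _)
  obtain ⟨i, hi⟩ := mem_fam.mp h₁
  obtain ⟨j, hj⟩ := mem_fam.mp h₂
  obtain ⟨ha, hb, hc⟩ := triad_factors_eq_of_two hK hi (hi ▸ h0 i)
  obtain ⟨ha', hb', hc'⟩ := triad_factors_eq_of_two hK hj (hj ▸ h0 j)
  -- the two flipped elements are different members of the family
  have hij : i ≠ j := by
    have hnd' := nodup_fam_of_inj hnd
    rw [hS, Multiset.nodup_cons] at hnd'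
    intro e
    apply hnd'.1
    rw [hi, e, ← hj]
    exact Multiset.mem_cons_self _ _
  -- the rest `R` is the family off `i, j`
  have hR : R = ((Finset.univ.erase i).erase j).val.map fun s => triad (w s) (u s) (v s) := by
    have e := hS
    rw [fam_eq_cons_cons hij, ← hi, ← hj] at e
    exact ((Multiset.cons_inj_right _).1 ((Multiset.cons_inj_right _).1 e)).symm
  have hw : w i = w j := ha.symm.trans ha'
  subst ha hb hc hb' hc'
  refine ⟨i, j, hij, hw, ?_⟩
  rcases hS' with hS' | hS'
  · left
    rw [hS', fam_eq_cons_cons_of_agree hij _ _ _ (fun s hsi hsj => by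
      rw [Function.update_of_ne hsj, Function.update_of_ne hsi]), hR,
      Function.update_of_ne hij, Function.update_self, Function.update_self,
      Function.update_of_ne hij.symm, triad_add₃, triad_sub₂, ← hw]
  · right
    rw [hS', fam_eq_cons_cons_of_agree hij _ _ _ (fun s hsi hsj => by
      rw [Function.update_of_ne hsi, Function.update_of_ne hsj]), hR,
      Function.update_self, Function.update_of_ne hij, Function.update_of_ne hij.symm,
      Function.update_self, triad_add₂, triad_sub₃, ← hw]

/-- `sw₁₂ (a⊗b⊗c) = b⊗a⊗c`. [folklore] -/
private theorem sw₁₂_triad'' (a : ι → K) (b : κ → K) (c : μ → K) :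
    sw₁₂ (triad a b c) = triad b a c := by
  funext x y z; simp only [sw₁₂, triad_apply]; ring

/-- `sw₁₃ (a⊗b⊗c) = c⊗b⊗a`. [folklore] -/
private theorem sw₁₃_triad'' (a : ι → K) (b : κ → K) (c : μ → K) :
    sw₁₃ (triad a b c) = triad c b a := by
  funext x y z; simp only [sw₁₃, triad_apply]; ring

omit [DecidableEq σ] in
/-- The family with the slots `(1 2)` exchanged. [folklore] -/
private theorem fam_map_sw₁₂' (w : σ → ι → K) (u : σ → κ → K) (v : σ → μ → K) :
    (fam w u v).map sw₁₂ = fam u w v := by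
  simp only [fam, Multiset.map_map, Function.comp_def, sw₁₂_triad'']

omit [DecidableEq σ] in
/-- The family with the slots `(1 3)` exchanged. [folklore] -/
private theorem fam_map_sw₁₃' (w : σ → ι → K) (u : σ → κ → K) (v : σ → μ → K) :
    (fam w u v).map sw₁₃ = fam v u w := by
  simp only [fam, Multiset.map_map, Function.comp_def, sw₁₃_triad'']

omit [Field K] [Fintype σ] [DecidableEq σ] in
/-- Undoing `sw₁₂` on a multiset. [folklore] -/
private theorem map_sw₁₂_map_sw₁₂ (M : Multiset (ι → κ → μ → K)) :
    (M.map sw₁₂).map sw₁₂ = M := by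
  rw [Multiset.map_map]
  conv_rhs => rw [← Multiset.map_id M]
  rfl

omit [Field K] [Fintype σ] [DecidableEq σ] in
/-- Undoing `sw₁₃` on a multiset. [folklore] -/
private theorem map_sw₁₃_map_sw₁₃ (M : Multiset (ι → κ → μ → K)) :
    (M.map sw₁₃).map sw₁₃ = M := by
  rw [Multiset.map_map]
  conv_rhs => rw [← Multiset.map_id M]
  rfl

omit [Fintype σ] [DecidableEq σ] in
/-- Non-vanishing of a rank-one tensor is a property of its factors. [folklore] -/
private theorem triad_ne_zero_perm {a : ι → K} {b : κ → K} {c : μ → K} (h : triad a b c ≠ 0) :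
    triad b a c ≠ 0 ∧ triad c b a ≠ 0 := by
  constructor
  · intro e; apply h
    have e' := congrArg sw₁₂ e
    rw [sw₁₂_triad''] at e'
    rw [e']; rfl
  · intro e; apply h
    have e' := congrArg sw₁₃ e
    rw [sw₁₃_triad''] at e'
    rw [e']; rfl

/-- **All flips of an injectively presented scheme over `ℤ₂`** (Def. 4 "for any permutation of
`A, B, Γ`": the shared factor in any slot): `S'` is the family with two members `i ≠ j` modified,
in one of six ways — shared `w_i = w_j` (modify `u, v`), shared `u_i = u_j` (modify `w, v`), or
shared `v_i = v_j` (modify `u, w`), each with the two choices of `T`.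
[cite: KauersMoosbauer2022FlipGraphs, Def. 4 (with §4, `K = ℤ₂`)] -/
theorem exists_update_of_flips (hK : ∀ x : K, x = 0 ∨ x = 1)
    (h0 : ∀ s, triad (w s) (u s) (v s) ≠ 0)
    (hnd : ∀ s s', s ≠ s' → triad (w s) (u s) (v s) ≠ triad (w s') (u s') (v s'))
    {S' : Multiset (ι → κ → μ → K)} (h : Flips (fam w u v) S') :
    ∃ i j, i ≠ j ∧
      ((w i = w j ∧
        (S' = fam w (Function.update u j (u j - u i)) (Function.update v i (v i + v j)) ∨
         S' = fam w (Function.update u i (u i + u j)) (Function.update v j (v j - v i)))) ∨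
       (u i = u j ∧
        (S' = fam (Function.update w j (w j - w i)) u (Function.update v i (v i + v j)) ∨
         S' = fam (Function.update w i (w i + w j)) u (Function.update v j (v j - v i)))) ∨
       (v i = v j ∧
        (S' = fam (Function.update w i (w i + w j)) (Function.update u j (u j - u i)) v ∨
         S' = fam (Function.update w j (w j - w i)) (Function.update u i (u i + u j)) v))) := by
  rcases h with h | h | h
  · obtain ⟨i, j, hij, hw, hS'⟩ := exists_update_of_flipBase hK h0 hnd h
    exact ⟨i, j, hij, Or.inl ⟨hw, hS'⟩⟩
  · rw [fam_map_sw₁₂'] at h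
    have h0' : ∀ s, triad (u s) (w s) (v s) ≠ 0 := fun s => (triad_ne_zero_perm (h0 s)).1
    have hnd' : ∀ s s', s ≠ s' → triad (u s) (w s) (v s) ≠ triad (u s') (w s') (v s') := by
      intro s s' hss' e
      apply hnd s s' hss'
      have e' := congrArg sw₁₂ e
      rwa [sw₁₂_triad'', sw₁₂_triad''] at e'
    obtain ⟨i, j, hij, hu, hS'⟩ := exists_update_of_flipBase hK h0' hnd' h
    refine ⟨i, j, hij, Or.inr (Or.inl ⟨hu, ?_⟩)⟩
    rcases hS' with hS' | hS'
    · left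
      rw [← map_sw₁₂_map_sw₁₂ S', hS', fam_map_sw₁₂']
    · right
      rw [← map_sw₁₂_map_sw₁₂ S', hS', fam_map_sw₁₂']
  · rw [fam_map_sw₁₃'] at h
    have h0' : ∀ s, triad (v s) (u s) (w s) ≠ 0 := fun s => (triad_ne_zero_perm (h0 s)).2
    have hnd' : ∀ s s', s ≠ s' → triad (v s) (u s) (w s) ≠ triad (v s') (u s') (w s') := by
      intro s s' hss' e
      apply hnd s s' hss'
      have e' := congrArg sw₁₃ e
      rwa [sw₁₃_triad'', sw₁₃_triad''] at e'
    obtain ⟨i, j, hij, hv, hS'⟩ := exists_update_of_flipBase hK h0' hnd' h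
    refine ⟨i, j, hij, Or.inr (Or.inr ⟨hv, ?_⟩)⟩
    rcases hS' with hS' | hS'
    · left
      rw [← map_sw₁₃_map_sw₁₃ S', hS', fam_map_sw₁₃']
    · right
      rw [← map_sw₁₃_map_sw₁₃ S', hS', fam_map_sw₁₃']

/-- **Conversely, the first modification IS a flip** (Def. 4 with `T = A ⊗ B ⊗ Γ'`): for members
`i ≠ j` with `w_i = w_j`, replacing `u_j, v_i` by `u_j − u_i, v_i + v_j` is a flip of the family
(any field). [cite: KauersMoosbauer2022FlipGraphs, Def. 4] -/
theorem flipBase_fam_update₁ {i j : σ} (hij : i ≠ j) (hw : w i = w j) :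
    FlipBase (fam w u v)
      (fam w (Function.update u j (u j - u i)) (Function.update v i (v i + v j))) := by
  refine ⟨w i, u i, u j, v i, v j,
    ((Finset.univ.erase i).erase j).val.map fun s => triad (w s) (u s) (v s), ?_, Or.inl ?_⟩
  · rw [fam_eq_cons_cons hij, hw]
  · rw [fam_eq_cons_cons_of_agree hij _ _ _ (fun s hsi hsj => by
      rw [Function.update_of_ne hsj, Function.update_of_ne hsi]),
      Function.update_of_ne hij, Function.update_self, Function.update_self,
      Function.update_of_ne hij.symm, triad_add₃, triad_sub₂, ← hw]

/-- **… and so is the second** (Def. 4 with `T = A ⊗ B' ⊗ Γ`): replacing `u_i, v_j` by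
`u_i + u_j, v_j − v_i`. [cite: KauersMoosbauer2022FlipGraphs, Def. 4] -/
theorem flipBase_fam_update₂ {i j : σ} (hij : i ≠ j) (hw : w i = w j) :
    FlipBase (fam w u v)
      (fam w (Function.update u i (u i + u j)) (Function.update v j (v j - v i))) := by
  refine ⟨w i, u i, u j, v i, v j,
    ((Finset.univ.erase i).erase j).val.map fun s => triad (w s) (u s) (v s), ?_, Or.inr ?_⟩
  · rw [fam_eq_cons_cons hij, hw]
  · rw [fam_eq_cons_cons_of_agree hij _ _ _ (fun s hsi hsj => by
      rw [Function.update_of_ne hsi, Function.update_of_ne hsj]),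
      Function.update_self, Function.update_of_ne hij, Function.update_of_ne hij.symm,
      Function.update_self, triad_add₂, triad_sub₃, ← hw]

/-- `sw₂₃ (a⊗b⊗c) = a⊗c⊗b`. [folklore] -/
private theorem sw₂₃_triad'' (a : ι → K) (b : κ → K) (c : μ → K) :
    sw₂₃ (triad a b c) = triad a c b := by
  funext x y z; simp only [sw₂₃, triad_apply]; ring

/-- `cyc (a⊗b⊗c) = b⊗c⊗a`. [folklore] -/
private theorem cyc_triad'' (a : ι → K) (b : κ → K) (c : μ → K) :
    cyc (triad a b c) = triad b c a := by
  funext x y z; simp only [cyc, triad_apply]; ring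

/-- `cyc₂ (a⊗b⊗c) = c⊗a⊗b`. [folklore] -/
private theorem cyc₂_triad'' (a : ι → K) (b : κ → K) (c : μ → K) :
    cyc₂ (triad a b c) = triad c a b := by
  funext x y z; simp only [cyc₂, triad_apply]; ring

omit [DecidableEq σ] in
/-- The family with the slots `(2 3)` exchanged. [folklore] -/
private theorem fam_map_sw₂₃' (w : σ → ι → K) (u : σ → κ → K) (v : σ → μ → K) :
    (fam w u v).map sw₂₃ = fam w v u := by
  simp only [fam, Multiset.map_map, Function.comp_def, sw₂₃_triad'']

omit [DecidableEq σ] in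
/-- The family with the slots cyclically permuted. [folklore] -/
private theorem fam_map_cyc' (w : σ → ι → K) (u : σ → κ → K) (v : σ → μ → K) :
    (fam w u v).map cyc = fam u v w := by
  simp only [fam, Multiset.map_map, Function.comp_def, cyc_triad'']

omit [DecidableEq σ] in
/-- The family with the slots cyclically permuted the other way. [folklore] -/
private theorem fam_map_cyc₂' (w : σ → ι → K) (u : σ → κ → K) (v : σ → μ → K) :
    (fam w u v).map cyc₂ = fam v w u := by
  simp only [fam, Multiset.map_map, Function.comp_def, cyc₂_triad'']

omit [Fintype σ] [DecidableEq σ] in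
/-- Over a field a rank-one tensor with non-zero factors is non-zero. [folklore] -/
private theorem triad_ne_zero_of_ne {a : ι → K} {b : κ → K} {c : μ → K} (ha : a ≠ 0) (hb : b ≠ 0)
    (hc : c ≠ 0) : triad a b c ≠ 0 := by
  obtain ⟨x, hx⟩ := Function.ne_iff.mp ha
  obtain ⟨y, hy⟩ := Function.ne_iff.mp hb
  obtain ⟨z, hz⟩ := Function.ne_iff.mp hc
  intro h
  have h' := congrFun (congrFun (congrFun h x) y) z
  simp only [triad_apply, Pi.zero_apply] at h'
  exact mul_ne_zero (mul_ne_zero hx hy) hz h'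

omit [Fintype σ] [DecidableEq σ] in
/-- Over `ℤ₂`, members with pairwise distinct factor TRIPLES are distinct tensors (the factors of a
non-zero rank-one tensor are determined). [cite: KauersMoosbauer2022FlipGraphs, Def. 1 (with §4, `K = ℤ₂`)] -/
theorem triad_ne_triad_of_factors (hK : ∀ x : K, x = 0 ∨ x = 1)
    (h0 : ∀ s, triad (w s) (u s) (v s) ≠ 0)
    (hfi : ∀ s s', w s = w s' → u s = u s' → v s = v s' → s = s') :
    ∀ s s', s ≠ s' → triad (w s) (u s) (v s) ≠ triad (w s') (u s') (v s') := by
  intro s s' hss' e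
  obtain ⟨h1, h2, h3⟩ := triad_factors_eq_of_two hK e (h0 s)
  exact hss' (hfi s s' h1 h2 h3)

/-- **No reduction in the written case (Prop. 3: `A^{(t)} = α_i A^{(i)}`, `B^{(t)} = Σ β_i B^{(i)}`)
applies** to an injectively presented scheme over `ℤ₂` in which, for every member `t`, some
coordinate of `u_t` is non-zero while it vanishes for every OTHER member with the same first factor
(then `B^{(t)}` is not a combination of those `B^{(i)}`) — the situation of the standard algorithm,
whose elements with a common factor have distinct basis vectors as their other factors.
[cite: KauersMoosbauer2022FlipGraphs, Prop. 3 and Def. 2 (with §4: "None of them is reducible")] -/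
theorem not_redBase_fam_of_sep (hK : ∀ x : K, x = 0 ∨ x = 1)
    (h0 : ∀ s, triad (w s) (u s) (v s) ≠ 0)
    (hnd : ∀ s s', s ≠ s' → triad (w s) (u s) (v s) ≠ triad (w s') (u s') (v s'))
    (hsep : ∀ t, ∃ x, u t x ≠ 0 ∧ ∀ i, i ≠ t → w i = w t → u i x = 0)
    (S' : Multiset (ι → κ → μ → K)) : ¬ RedBase (fam w u v) S' := by
  rintro ⟨a₀, b₀, c₀, R, L, L₀, hS, hA, hB, -, -⟩
  have hT₀ : triad a₀ b₀ c₀ ∈ fam w u v := by rw [hS]; exact Multiset.mem_cons_self _ _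
  obtain ⟨t, ht⟩ := mem_fam.mp hT₀
  obtain ⟨ha, hb, -⟩ := triad_factors_eq_of_two hK ht (ht ▸ h0 t)
  have hnd' := nodup_fam_of_inj hnd
  rw [hS, Multiset.nodup_cons] at hnd'
  -- every modified element is a member `i ≠ t` of the family with `w i = w t`
  have hmod : ∀ q ∈ L + L₀, ∃ i, i ≠ t ∧ w i = w t ∧ q.1.2.1 = u i := by
    intro q hq
    have hmem : tr q.1 ∈ (L + L₀).map (fun q => tr q.1) + R :=
      Multiset.mem_add.mpr (Or.inl (Multiset.mem_map_of_mem _ hq))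
    have hmem' : tr q.1 ∈ fam w u v := by rw [hS]; exact Multiset.mem_cons_of_mem hmem
    obtain ⟨i, hi⟩ := mem_fam.mp hmem'
    have hi' : triad q.1.1 q.1.2.1 q.1.2.2 = triad (w i) (u i) (v i) := hi
    obtain ⟨hqa, hqb, -⟩ := triad_factors_eq_of_two hK hi' (hi' ▸ h0 i)
    have hit : i ≠ t := by
      rintro rfl
      exact hnd'.1 (by rw [ht, ← hi]; exact hmem)
    have hwi : w i ≠ 0 := by
      intro e
      apply h0 i
      funext x y z; simp [triad_apply, e]
    have hα : q.2.1 = 1 := by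
      rcases hK q.2.1 with h | h
      · exfalso
        apply (show a₀ ≠ 0 from fun e => by
          apply h0 t; rw [← ht]; funext x y z; simp [triad_apply, e])
        rw [hA q hq, h, zero_smul]
      · exact h
    refine ⟨i, hit, ?_, hqb⟩
    have e := hA q hq
    rw [hα, one_smul, hqa] at e
    rw [← e, ha]
  -- evaluate `B^{(t)} = Σ β_i B^{(i)}` at the separating coordinate
  have hsum : ∀ (M : Multiset (κ → K)) (y : κ), M.sum y = (M.map fun f => f y).sum := by
    intro M y
    induction M using Multiset.induction_on with
    | empty => simp
    | cons f M ih => simp [ih]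
  obtain ⟨x, hx, hzero⟩ := hsep t
  apply hx
  rw [← hb, hB, hsum, Multiset.map_map]
  refine Multiset.sum_eq_zero fun y hy => ?_
  obtain ⟨q, hq, rfl⟩ := Multiset.mem_map.mp hy
  obtain ⟨i, hit, hwi, hqb⟩ := hmod q hq
  simp only [Function.comp_apply, Pi.smul_apply, smul_eq_mul, hqb, hzero i hit hwi, mul_zero]

/-- **No reduction at all (all six cases of Def. 2)** applies to an injectively presented scheme
over `ℤ₂` with non-zero factors in which every ordered pair of slots is "separated" in the above
sense — the standard algorithm. [cite: KauersMoosbauer2022FlipGraphs, Def. 2 and Prop. 3 (with §4: "None of them is reducible")] -/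
theorem not_reduces_fam_of_sep (hK : ∀ x : K, x = 0 ∨ x = 1)
    (hne : ∀ s, w s ≠ 0 ∧ u s ≠ 0 ∧ v s ≠ 0)
    (hfi : ∀ s s', w s = w s' → u s = u s' → v s = v s' → s = s')
    (hwu : ∀ t, ∃ x, u t x ≠ 0 ∧ ∀ i, i ≠ t → w i = w t → u i x = 0)
    (hwv : ∀ t, ∃ x, v t x ≠ 0 ∧ ∀ i, i ≠ t → w i = w t → v i x = 0)
    (huw : ∀ t, ∃ x, w t x ≠ 0 ∧ ∀ i, i ≠ t → u i = u t → w i x = 0)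
    (huv : ∀ t, ∃ x, v t x ≠ 0 ∧ ∀ i, i ≠ t → u i = u t → v i x = 0)
    (hvw : ∀ t, ∃ x, w t x ≠ 0 ∧ ∀ i, i ≠ t → v i = v t → w i x = 0)
    (hvu : ∀ t, ∃ x, u t x ≠ 0 ∧ ∀ i, i ≠ t → v i = v t → u i x = 0)
    (S' : Multiset (ι → κ → μ → K)) : ¬ Reduces (fam w u v) S' := by
  have n₁ := fun s => triad_ne_zero_of_ne (hne s).1 (hne s).2.1 (hne s).2.2
  have n₂ := fun s => triad_ne_zero_of_ne (hne s).1 (hne s).2.2 (hne s).2.1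
  have n₃ := fun s => triad_ne_zero_of_ne (hne s).2.1 (hne s).1 (hne s).2.2
  have n₄ := fun s => triad_ne_zero_of_ne (hne s).2.1 (hne s).2.2 (hne s).1
  have n₅ := fun s => triad_ne_zero_of_ne (hne s).2.2 (hne s).1 (hne s).2.1
  have n₆ := fun s => triad_ne_zero_of_ne (hne s).2.2 (hne s).2.1 (hne s).1
  rintro (h | h | h | h | h | h)
  · exact not_redBase_fam_of_sep hK n₁
      (triad_ne_triad_of_factors hK n₁ hfi) hwu S' h
  · rw [fam_map_sw₂₃'] at h
    exact not_redBase_fam_of_sep hK n₂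
      (triad_ne_triad_of_factors hK n₂ fun s s' h1 h2 h3 => hfi s s' h1 h3 h2) hwv _ h
  · rw [fam_map_sw₁₂'] at h
    exact not_redBase_fam_of_sep hK n₃
      (triad_ne_triad_of_factors hK n₃ fun s s' h1 h2 h3 => hfi s s' h2 h1 h3) huw _ h
  · rw [fam_map_cyc'] at h
    exact not_redBase_fam_of_sep hK n₄
      (triad_ne_triad_of_factors hK n₄ fun s s' h1 h2 h3 => hfi s s' h3 h1 h2) huv _ h
  · rw [fam_map_cyc₂'] at h
    exact not_redBase_fam_of_sep hK n₅
      (triad_ne_triad_of_factors hK n₅ fun s s' h1 h2 h3 => hfi s s' h2 h3 h1) hvw _ h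
  · rw [fam_map_sw₁₃'] at h
    exact not_redBase_fam_of_sep hK n₆
      (triad_ne_triad_of_factors hK n₆ fun s s' h1 h2 h3 => hfi s s' h3 h2 h1) hvu _ h

end FamFlips

/-! ## §2 Permutation sandwiches relabel the indices (any field, any `n`) -/

section Relabel

variable {K : Type*} [Field K] {n : ℕ}

/-- A permutation matrix is invertible. [folklore] -/
private theorem isUnit_det_permMatrix (π : Equiv.Perm (Fin n)) :
    IsUnit (π.permMatrix K).det := by
  rw [det_permutation]
  rcases Int.units_eq_one_or (Equiv.Perm.sign π) with h | h <;> simp [h]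

/-- **The permutation sandwich `(P_π, P_σ, P_ρ)`** — the sandwich symmetry of `⟨n,n,n⟩` (KM §2 /
de Groote) with permutation matrices: an element of KM's group `G` relabelling row, inner and
column indices. [cite: KauersMoosbauer2022FlipGraphs, §2 (symmetry group)] -/
noncomputable def relabelSym (π σ ρ : Equiv.Perm (Fin n)) : Symmetry (matMulTensor K n n n) :=
  Symmetry.sandwich (π.permMatrix K) (σ.permMatrix K) (ρ.permMatrix K)
    (isUnit_det_permMatrix π) (isUnit_det_permMatrix σ) (isUnit_det_permMatrix ρ)

/-- It belongs to `G`. [cite: KauersMoosbauer2022FlipGraphs, §2 (symmetry group)] -/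
theorem inSymmetryGroup_relabelSym (π σ ρ : Equiv.Perm (Fin n)) :
    InSymmetryGroup (relabelSym (K := K) π σ ρ) :=
  InSymmetryGroup.sandwich _ _ _ _ _ _

/-- `P_π⁻¹ = P_{π⁻¹}`. [folklore] -/
private theorem permMatrix_inv (π : Equiv.Perm (Fin n)) :
    (π.permMatrix K)⁻¹ = (π⁻¹).permMatrix K := by
  refine Matrix.inv_eq_left_inv ?_
  rw [← Matrix.permMatrix_mul, mul_inv_cancel, Matrix.permMatrix_one]

/-- `P_π⁻ᵀ = P_π`. [folklore] -/
private theorem permMatrix_inv_transpose (π : Equiv.Perm (Fin n)) :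
    (π.permMatrix K)⁻¹ᵀ = π.permMatrix K := by
  rw [permMatrix_inv, Matrix.transpose_permMatrix, inv_inv]

/-- `P_π ⊗ₖ P_ρ` acts on `K^{n×n}` by relabelling: `((P_π ⊗ P_ρ) z)(a,b) = z(π a, ρ b)`. [folklore] -/
private theorem kronecker_permMatrix_mulVec (π ρ : Equiv.Perm (Fin n)) (z : Fin n × Fin n → K) :
    (π.permMatrix K ⊗ₖ ρ.permMatrix K) *ᵥ z = fun p => z (π p.1, ρ p.2) := by
  have e : π.permMatrix K ⊗ₖ ρ.permMatrix K = Equiv.Perm.permMatrix K (Equiv.prodCongr π ρ) := by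
    ext ⟨a, b⟩ ⟨c, d⟩
    simp only [Matrix.kroneckerMap_apply, Equiv.Perm.permMatrix, PEquiv.toMatrix_apply,
      Equiv.toPEquiv_apply, Option.mem_def, Option.some.injEq, Equiv.prodCongr_apply,
      Prod.map_apply, Prod.mk.injEq]
    by_cases h1 : π a = c <;> by_cases h2 : ρ b = d <;> simp [h1, h2]
  rw [e, Matrix.permMatrix_mulVec]
  rfl

/-- **The permutation sandwich relabels every rank-one tensor:**
`(P_π, P_σ, P_ρ) · (z ⊗ x ⊗ y) = z(π·, ρ·) ⊗ x(π·, σ·) ⊗ y(σ·, ρ·)`.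
[cite: KauersMoosbauer2022FlipGraphs, §2 (symmetry group)] -/
theorem relabelSym_triad (π σ ρ : Equiv.Perm (Fin n)) (z x y : Fin n × Fin n → K) :
    (relabelSym π σ ρ).toLinearEquiv (triad z x y) =
      triad (fun p => z (π p.1, ρ p.2)) (fun p => x (π p.1, σ p.2)) (fun p => y (σ p.1, ρ p.2)) := by
  show actTensor ((π.permMatrix K)⁻¹ᵀ ⊗ₖ (ρ.permMatrix K)⁻¹ᵀ) (π.permMatrix K ⊗ₖ σ.permMatrix K)
      ((σ.permMatrix K)⁻¹ᵀ ⊗ₖ ρ.permMatrix K) (triad z x y) = _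
  rw [permMatrix_inv_transpose, permMatrix_inv_transpose, permMatrix_inv_transpose, actTensor_triad,
    kronecker_permMatrix_mulVec, kronecker_permMatrix_mulVec, kronecker_permMatrix_mulVec]

/-- The cyclic shift on rank-one tensors, as a statement about `Symmetry.cycleSq`.
[cite: KauersMoosbauer2022FlipGraphs, §2 (symmetry group)] -/
theorem cycleSq_triad (z x y : Fin n × Fin n → K) :
    (Symmetry.cycleSq (K := K) n).toLinearEquiv (triad z x y) =
      triad (fun p => x p.swap) y (fun p => z p.swap) :=
  cycleMap_triad z x y

end Relabel


/-! ## §2b A `G`-invariant: "some element has a factor shared with no other element" -/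

section Lonely

variable {K : Type*} [Field K] {ι κ μ : Type*}

/-- Two rank-one tensors presented with a common factor in slot `i` (`i = 0, 1, 2` for `Z, X, Y`).
[cite: KauersMoosbauer2022FlipGraphs, Def. 4 ("two elements `A⊗B⊗Γ`, `A⊗B'⊗Γ'`")] -/
def ShareAt (i : Fin 3) (T T' : ι → κ → μ → K) : Prop :=
  if i = 0 then ∃ (a : ι → K) (b b' : κ → K) (c c' : μ → K), T = triad a b c ∧ T' = triad a b' c'
  else if i = 1 then ∃ (b : κ → K) (a a' : ι → K) (c c' : μ → K), T = triad a b c ∧ T' = triad a' b c'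
  else ∃ (c : μ → K) (a a' : ι → K) (b b' : κ → K), T = triad a b c ∧ T' = triad a' b' c

/-- **Lonely factor:** some element of the multiset `S` has, in some slot, a factor presentation
shared with no other element of `S` (an element of `S ∖ {T}`). An orbit invariant in the spirit of
the invariants HKS §4 use to tell orbits apart (theirs are built from the ranks of the factors;
this simpler one — ours, used below only to separate the orbit of `N₀` from that of the standard
algorithm — from the incidences "two elements share a factor", which every element of KM's group
preserves up to a permutation of the slots, `Lonely.map`).
[cite: HeuleKauersSeidl2021, §4 (invariants of schemes under the symmetry group `G`)] -/
def Lonely [DecidableEq (ι → κ → μ → K)] (S : Multiset (ι → κ → μ → K)) : Prop :=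
  ∃ T ∈ S, ∃ i : Fin 3, ∀ T' ∈ S.erase T, ¬ ShareAt i T T'

/-- A factorwise linear map preserves sharing in every slot. [folklore] -/
private theorem shareAt_actTensor {ι' κ' μ' : Type*} [Fintype ι] [Fintype κ] [Fintype μ]
    (A : Matrix ι' ι K) (B : Matrix κ' κ K) (C : Matrix μ' μ K) (i : Fin 3)
    {T T' : ι → κ → μ → K} (h : ShareAt i T T') :
    ShareAt i (actTensor A B C T) (actTensor A B C T') := by
  unfold ShareAt at h ⊢
  split_ifs at h ⊢ with h0 h1
  · obtain ⟨a, b, b', c, c', rfl, rfl⟩ := h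
    exact ⟨_, _, _, _, _, actTensor_triad A B C a b c, actTensor_triad A B C a b' c'⟩
  · obtain ⟨b, a, a', c, c', rfl, rfl⟩ := h
    exact ⟨_, _, _, _, _, actTensor_triad A B C a b c, actTensor_triad A B C a' b c'⟩
  · obtain ⟨c, a, a', b, b', rfl, rfl⟩ := h
    exact ⟨_, _, _, _, _, actTensor_triad A B C a b c, actTensor_triad A B C a' b' c⟩

variable {n : ℕ}

/-- The slot permutation of the cyclic shift `(Z, X, Y) ↦ (Xᵀ, Y, Zᵀ)`: a factor shared in slot
`Z` (resp. `X`, `Y`) becomes shared in slot `Y` (resp. `Z`, `X`). [cite: KauersMoosbauer2022FlipGraphs, §2] -/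
def cycSlot : Equiv.Perm (Fin 3) := ⟨![2, 0, 1], ![1, 2, 0], by decide, by decide⟩

/-- The slot permutation of the transposition `(Z, X, Y) ↦ (Zᵀ, Yᵀ, Xᵀ)`. [cite: KauersMoosbauer2022FlipGraphs, §2] -/
def trSlot : Equiv.Perm (Fin 3) := Equiv.swap 1 2

/-- The cyclic shift moves sharing from slot `i` to slot `cycSlot i`. [cite: KauersMoosbauer2022FlipGraphs, §2] -/
private theorem shareAt_cycleMap (i : Fin 3) {T T' : (Fin n × Fin n) → (Fin n × Fin n) → (Fin n × Fin n) → K}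
    (h : ShareAt i T T') : ShareAt (cycSlot i) (cycleMap n T) (cycleMap n T') := by
  fin_cases i
  · obtain ⟨a, b, b', c, c', rfl, rfl⟩ : ∃ (a : _ → K) (b b' : _ → K) (c c' : _ → K),
        T = triad a b c ∧ T' = triad a b' c' := by simpa [ShareAt] using h
    show ShareAt 2 _ _
    simp only [ShareAt, cycleMap_triad]
    exact ⟨_, _, _, _, _, rfl, rfl⟩
  · obtain ⟨b, a, a', c, c', rfl, rfl⟩ : ∃ (b : _ → K) (a a' : _ → K) (c c' : _ → K),
        T = triad a b c ∧ T' = triad a' b c' := by simpa [ShareAt] using h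
    show ShareAt 0 _ _
    simp only [ShareAt, cycleMap_triad]
    exact ⟨_, _, _, _, _, rfl, rfl⟩
  · obtain ⟨c, a, a', b, b', rfl, rfl⟩ : ∃ (c : _ → K) (a a' : _ → K) (b b' : _ → K),
        T = triad a b c ∧ T' = triad a' b' c := by simpa [ShareAt] using h
    show ShareAt 1 _ _
    simp only [ShareAt, cycleMap_triad]
    exact ⟨_, _, _, _, _, rfl, rfl⟩

/-- The inverse cyclic shift moves sharing from slot `cycSlot i` back to slot `i`.
[cite: KauersMoosbauer2022FlipGraphs, §2] -/
private theorem shareAt_cycleMapInv (i : Fin 3)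
    {T T' : (Fin n × Fin n) → (Fin n × Fin n) → (Fin n × Fin n) → K}
    (h : ShareAt (cycSlot i) T T') : ShareAt i (cycleMapInv n T) (cycleMapInv n T') := by
  fin_cases i
  · obtain ⟨c, a, a', b, b', rfl, rfl⟩ : ∃ (c : _ → K) (a a' : _ → K) (b b' : _ → K),
        T = triad a b c ∧ T' = triad a' b' c := by simpa [ShareAt, cycSlot] using h
    show ShareAt 0 _ _
    simp only [ShareAt, cycleMapInv_triad]
    exact ⟨_, _, _, _, _, rfl, rfl⟩
  · obtain ⟨a, b, b', c, c', rfl, rfl⟩ : ∃ (a : _ → K) (b b' : _ → K) (c c' : _ → K),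
        T = triad a b c ∧ T' = triad a b' c' := by simpa [ShareAt, cycSlot] using h
    show ShareAt 1 _ _
    simp only [ShareAt, cycleMapInv_triad]
    exact ⟨_, _, _, _, _, rfl, rfl⟩
  · obtain ⟨b, a, a', c, c', rfl, rfl⟩ : ∃ (b : _ → K) (a a' : _ → K) (c c' : _ → K),
        T = triad a b c ∧ T' = triad a' b c' := by simpa [ShareAt, cycSlot] using h
    show ShareAt 2 _ _
    simp only [ShareAt, cycleMapInv_triad]
    exact ⟨_, _, _, _, _, rfl, rfl⟩

/-- The transposition moves sharing from slot `i` to slot `trSlot i`. [cite: KauersMoosbauer2022FlipGraphs, §2] -/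
private theorem shareAt_transposeMap (i : Fin 3)
    {T T' : (Fin n × Fin n) → (Fin n × Fin n) → (Fin n × Fin n) → K}
    (h : ShareAt i T T') : ShareAt (trSlot i) (transposeMap n T) (transposeMap n T') := by
  fin_cases i
  · obtain ⟨a, b, b', c, c', rfl, rfl⟩ : ∃ (a : _ → K) (b b' : _ → K) (c c' : _ → K),
        T = triad a b c ∧ T' = triad a b' c' := by simpa [ShareAt] using h
    show ShareAt 0 _ _
    simp only [ShareAt, transposeMap_triad]
    exact ⟨_, _, _, _, _, rfl, rfl⟩
  · obtain ⟨b, a, a', c, c', rfl, rfl⟩ : ∃ (b : _ → K) (a a' : _ → K) (c c' : _ → K),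
        T = triad a b c ∧ T' = triad a' b c' := by simpa [ShareAt] using h
    show ShareAt 2 _ _
    simp only [ShareAt, transposeMap_triad]
    exact ⟨_, _, _, _, _, rfl, rfl⟩
  · obtain ⟨c, a, a', b, b', rfl, rfl⟩ : ∃ (c : _ → K) (a a' : _ → K) (b b' : _ → K),
        T = triad a b c ∧ T' = triad a' b' c := by simpa [ShareAt] using h
    show ShareAt 1 _ _
    simp only [ShareAt, transposeMap_triad]
    exact ⟨_, _, _, _, _, rfl, rfl⟩

/-- **Every element of KM's group `G` permutes the slots of shared factors:** for `g ∈ G` there is a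
permutation `π` of the three slots with "`T, T'` share a factor in slot `i`" iff "`g T, g T'` share a
factor in slot `π i`". [cite: KauersMoosbauer2022FlipGraphs, §2 ("symmetry transformations act
linearly on the individual matrices"), §3] -/
theorem InSymmetryGroup.exists_slotPerm {φ : Symmetry (matMulTensor K n n n)}
    (hφ : InSymmetryGroup φ) : ∃ π : Equiv.Perm (Fin 3), ∀ i T T',
      ShareAt i T T' ↔ ShareAt (π i) (φ.toLinearEquiv T) (φ.toLinearEquiv T') := by
  induction hφ with
  | sandwich P Q R hP hQ hR =>
    refine ⟨1, fun i T T' => ⟨fun h => ?_, fun h => ?_⟩⟩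
    · exact shareAt_actTensor _ _ _ i h
    · have e : ∀ U, (Symmetry.sandwich P Q R hP hQ hR).toLinearEquiv.symm
          ((Symmetry.sandwich P Q R hP hQ hR).toLinearEquiv U) = U := fun U =>
        LinearEquiv.symm_apply_apply _ U
      rw [← e T, ← e T']
      exact shareAt_actTensor (Pᵀ ⊗ₖ Rᵀ) (P⁻¹ ⊗ₖ Q⁻¹) (Qᵀ ⊗ₖ R⁻¹) _ h
  | cycle =>
    refine ⟨cycSlot, fun i T T' => ⟨fun h => shareAt_cycleMap i h, fun h => ?_⟩⟩
    have e : ∀ U : (Fin n × Fin n) → (Fin n × Fin n) → (Fin n × Fin n) → K,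
        cycleMapInv n (cycleMap n U) = U := fun U => by funext a b c; simp [cycleMap, cycleMapInv]
    rw [← e T, ← e T']
    exact shareAt_cycleMapInv i h
  | transpose =>
    refine ⟨trSlot, fun i T T' => ⟨fun h => shareAt_transposeMap i h, fun h => ?_⟩⟩
    have e : ∀ U : (Fin n × Fin n) → (Fin n × Fin n) → (Fin n × Fin n) → K,
        transposeMap n (transposeMap n U) = U := fun U => by funext a b c; simp [transposeMap]
    have hi : trSlot (trSlot i) = i := by
      fin_cases i <;> decide
    rw [← e T, ← e T', ← hi]
    exact shareAt_transposeMap (trSlot i) h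
  | refl => exact ⟨1, fun i T T' => Iff.rfl⟩
  | @symm φ _ ih =>
    obtain ⟨π, hπ⟩ := ih
    refine ⟨π.symm, fun i T T' => ?_⟩
    have h := hπ (π.symm i) (φ.toLinearEquiv.symm T) (φ.toLinearEquiv.symm T')
    rw [Equiv.apply_symm_apply, LinearEquiv.apply_symm_apply, LinearEquiv.apply_symm_apply] at h
    exact h.symm
  | @trans φ ψ _ _ ihφ ihψ =>
    obtain ⟨π, hπ⟩ := ihφ
    obtain ⟨π', hπ'⟩ := ihψ
    exact ⟨π.trans π', fun i T T' => (hπ i T T').trans (hπ' (π i) _ _)⟩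

/-- **The lonely-factor property is invariant under KM's group** (hence a property of orbits,
i.e. of the vertices of the flip graph). [cite: KauersMoosbauer2022FlipGraphs, §2–§3 (compatibility
of the group action)] -/
theorem Lonely.map [DecidableEq ((Fin n × Fin n) → (Fin n × Fin n) → (Fin n × Fin n) → K)]
    {φ : Symmetry (matMulTensor K n n n)} (hφ : InSymmetryGroup φ)
    {S : Multiset ((Fin n × Fin n) → (Fin n × Fin n) → (Fin n × Fin n) → K)} (h : Lonely S) :
    Lonely (S.map φ.toLinearEquiv) := by
  obtain ⟨π, hπ⟩ := hφ.exists_slotPerm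
  obtain ⟨T, hT, i, hi⟩ := h
  refine ⟨φ.toLinearEquiv T, Multiset.mem_map_of_mem _ hT, π i, fun U hU hsh => ?_⟩
  rw [← Multiset.map_erase _ φ.toLinearEquiv.injective, Multiset.mem_map] at hU
  obtain ⟨T', hT', rfl⟩ := hU
  exact hi T' hT' ((hπ i T T').2 hsh)

/-- Hence equivalent schemes are lonely together. [cite: KauersMoosbauer2022FlipGraphs, §2 (equivalence of schemes)] -/
theorem lonely_iff_of_equiv [DecidableEq ((Fin n × Fin n) → (Fin n × Fin n) → (Fin n × Fin n) → K)]
    {x y : Scheme (matMulTensor K n n n)} (h : (orbitSetoidKM K n).r x y) :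
    Lonely x.elts ↔ Lonely y.elts := by
  obtain ⟨φ, hφ, rfl⟩ := h
  refine ⟨fun hx => hx.map hφ, fun hy => ?_⟩
  have e := congrArg Scheme.elts (Scheme.map_map_symm φ x)
  rw [Scheme.map_elts] at e
  rw [← e]
  exact hy.map hφ.symm

variable {σ : Type*} [Fintype σ] [DecidableEq σ] {w : σ → ι → K} {u : σ → κ → K} {v : σ → μ → K}

/-- **The lonely-factor property read off the factors** of an injective presentation over `ℤ₂`:
some member's `i`-th factor differs from the `i`-th factor of every other member.
[cite: HeuleKauersSeidl2021, §4 (invariants of schemes under the symmetry group `G`)] -/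
def LonelyFam (w : σ → ι → K) (u : σ → κ → K) (v : σ → μ → K) : Prop :=
  ∃ s, (∀ s', s' ≠ s → w s' ≠ w s) ∨ (∀ s', s' ≠ s → u s' ≠ u s) ∨ (∀ s', s' ≠ s → v s' ≠ v s)

/-- `LonelyFam` is decidable for finite index and factor types. [cite: KauersMoosbauer2022FlipGraphs, Def. 1] -/
instance [DecidableEq (ι → K)] [DecidableEq (κ → K)] [DecidableEq (μ → K)] :
    Decidable (LonelyFam w u v) := by
  unfold LonelyFam; infer_instance

omit [DecidableEq σ] in
/-- `Lonely (fam w u v) → LonelyFam w u v` (any field; injective presentation).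
[cite: KauersMoosbauer2022FlipGraphs, Def. 1] -/
theorem lonelyFam_of_lonely [DecidableEq (ι → κ → μ → K)]
    (hnd : ∀ s s', s ≠ s' → triad (w s) (u s) (v s) ≠ triad (w s') (u s') (v s'))
    (h : Lonely (fam w u v)) : LonelyFam w u v := by
  obtain ⟨T, hT, i, hi⟩ := h
  obtain ⟨s, rfl⟩ := mem_fam.mp hT
  have hmem : ∀ s', s' ≠ s → triad (w s') (u s') (v s') ∈ (fam w u v).erase (triad (w s) (u s) (v s)) :=
    fun s' hs' => (Multiset.mem_erase_of_ne (hnd s' s hs')).2 (mem_fam.mpr ⟨s', rfl⟩)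
  refine ⟨s, ?_⟩
  fin_cases i
  · refine Or.inl fun s' hs' e => hi _ (hmem s' hs') ?_
    simp only [ShareAt]
    exact ⟨w s, u s, u s', v s, v s', rfl, by rw [← e]⟩
  · refine Or.inr (Or.inl fun s' hs' e => hi _ (hmem s' hs') ?_)
    simp only [ShareAt]
    exact ⟨u s, w s, w s', v s, v s', rfl, by rw [← e]⟩
  · refine Or.inr (Or.inr fun s' hs' e => hi _ (hmem s' hs') ?_)
    simp only [ShareAt]
    exact ⟨v s, w s, w s', u s, u s', rfl, by rw [← e]⟩

/-- `LonelyFam w u v → Lonely (fam w u v)` over `ℤ₂` (non-zero members: the factors of a member are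
determined, `triad_factors_eq_of_two`). [cite: KauersMoosbauer2022FlipGraphs, Def. 1 (with §4, `K = ℤ₂`)] -/
theorem lonely_of_lonelyFam [DecidableEq (ι → κ → μ → K)] (hK : ∀ x : K, x = 0 ∨ x = 1)
    (h0 : ∀ s, triad (w s) (u s) (v s) ≠ 0)
    (hnd : ∀ s s', s ≠ s' → triad (w s) (u s) (v s) ≠ triad (w s') (u s') (v s'))
    (h : LonelyFam w u v) : Lonely (fam w u v) := by
  obtain ⟨s, hs⟩ := h
  have hnodup : (fam w u v).Nodup := nodup_fam_of_inj hnd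
  -- the other elements of the multiset are the members `s' ≠ s`
  have hother : ∀ T' ∈ (fam w u v).erase (triad (w s) (u s) (v s)), ∃ s', s' ≠ s ∧
      T' = triad (w s') (u s') (v s') := by
    intro T' hT'
    obtain ⟨s', rfl⟩ := mem_fam.mp (Multiset.mem_of_mem_erase hT')
    refine ⟨s', fun e => ?_, rfl⟩
    subst e
    exact ((Multiset.Nodup.mem_erase_iff hnodup).1 hT').1 rfl
  refine ⟨_, mem_fam.mpr ⟨s, rfl⟩, ?_⟩
  rcases hs with hs | hs | hs
  · refine ⟨0, fun T' hT' hsh => ?_⟩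
    obtain ⟨s', hs', rfl⟩ := hother T' hT'
    simp only [ShareAt] at hsh
    obtain ⟨a, b, b', c, c', e₁, e₂⟩ := hsh
    exact hs s' hs' ((triad_factors_eq_of_two hK e₂.symm (e₂ ▸ h0 s')).1.symm.trans
      (triad_factors_eq_of_two hK e₁.symm (e₁ ▸ h0 s)).1)
  · refine ⟨1, fun T' hT' hsh => ?_⟩
    obtain ⟨s', hs', rfl⟩ := hother T' hT'
    simp only [ShareAt] at hsh
    obtain ⟨b, a, a', c, c', e₁, e₂⟩ := hsh
    exact hs s' hs' ((triad_factors_eq_of_two hK e₂.symm (e₂ ▸ h0 s')).2.1.symm.trans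
      (triad_factors_eq_of_two hK e₁.symm (e₁ ▸ h0 s)).2.1)
  · refine ⟨2, fun T' hT' hsh => ?_⟩
    obtain ⟨s', hs', rfl⟩ := hother T' hT'
    simp only [ShareAt] at hsh
    obtain ⟨c, a, a', b, b', e₁, e₂⟩ := hsh
    exact hs s' hs' ((triad_factors_eq_of_two hK e₂.symm (e₂ ▸ h0 s')).2.2.symm.trans
      (triad_factors_eq_of_two hK e₁.symm (e₁ ▸ h0 s)).2.2)

end Lonely

/-! ## §3 The standard algorithm of `⟨n,n,n⟩` over `ℤ₂`: its flips and the witnesses of their equivalence -/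

end FlipGraph

namespace StdNeighbourZ2

open FlipGraph

/-- The factor space `ℤ₂^{n×n}` (the matrices `A, B, Γ`). [cite: KauersMoosbauer2022FlipGraphs, Def. 1] -/
abbrev F (n : ℕ) : Type := Fin n × Fin n → ZMod 2

/-- The index set `(κ, μ, ν)` of the `n³` products of the standard algorithm.
[cite: KauersMoosbauer2022FlipGraphs, §2 (the standard algorithm)] -/
abbrev Idx (n : ℕ) : Type := Fin n × Fin n × Fin n

/-- A scheme presented by factor families (`Z`-, `X`-, `Y`-factors indexed by `Idx n`).
[cite: KauersMoosbauer2022FlipGraphs, Def. 1] -/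
abbrev Fam3 (n : ℕ) : Type := (Idx n → F n) × (Idx n → F n) × (Idx n → F n)

/-- A witness of equivalence: `k` cyclic shifts after the permutation sandwich `(π, σ, ρ)`.
[cite: KauersMoosbauer2022FlipGraphs, §2 (symmetry group)] -/
abbrev Wit (n : ℕ) : Type := Fin 3 × Equiv.Perm (Fin n) × Equiv.Perm (Fin n) × Equiv.Perm (Fin n)

variable (n : ℕ)

/-- The basis vector `e_{ab} ∈ ℤ₂^{n×n}` (written with `if` for fast kernel evaluation; equal to
`Pi.single (a, b) 1`, `e_eq_single`). [cite: KauersMoosbauer2022FlipGraphs, §2] -/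
def e (a b : Fin n) : F n := fun q => if q = (a, b) then 1 else 0

/-- `e a b = Pi.single (a, b) 1`. [cite: KauersMoosbauer2022FlipGraphs, §2] -/
theorem e_eq_single (a b : Fin n) : e n a b = Pi.single (a, b) 1 := by
  funext q; simp [e, Pi.single_apply]

/-- The `Z`-factors `e_{κν}` of the standard algorithm. [cite: KauersMoosbauer2022FlipGraphs, §2] -/
def sW : Idx n → F n := fun p => e n p.1 p.2.2
/-- The `X`-factors `e_{κμ}` of the standard algorithm. [cite: KauersMoosbauer2022FlipGraphs, §2] -/
def sU : Idx n → F n := fun p => e n p.1 p.2.1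
/-- The `Y`-factors `e_{μν}` of the standard algorithm. [cite: KauersMoosbauer2022FlipGraphs, §2] -/
def sV : Idx n → F n := fun p => e n p.2.1 p.2.2

/-- Modifying one member of a family (`= Function.update`, written with `if` for fast kernel
evaluation; `update_eq_upd`). [folklore] -/
def upd (f : Idx n → F n) (i : Idx n) (x : F n) : Idx n → F n := fun s => if s = i then x else f s

/-- `Function.update f i x = upd f i x`. [folklore] -/
private theorem update_eq_upd (f : Idx n → F n) (i : Idx n) (x : F n) :
    Function.update f i x = upd n f i x := by
  funext s; rw [Function.update_apply]; rfl

/-- The multiset presented by a triple of factor families. [cite: KauersMoosbauer2022FlipGraphs, Def. 1] -/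
def fam3 (Φ : Fam3 n) : Multiset ((Fin n × Fin n) → (Fin n × Fin n) → (Fin n × Fin n) → ZMod 2) :=
  fam Φ.1 Φ.2.1 Φ.2.2

/-- The multiset of factor TRIPLES of a triple of families (over `ℤ₂` it determines the scheme and
is cheap to compare). [cite: KauersMoosbauer2022FlipGraphs, Def. 1] -/
def tms (Φ : Fam3 n) : Multiset (F n × F n × F n) :=
  (Finset.univ : Finset (Idx n)).val.map fun s => (Φ.1 s, Φ.2.1 s, Φ.2.2 s)

/-- The standard algorithm's elements are the family `(sW, sU, sV)`.
[cite: KauersMoosbauer2022FlipGraphs, §2 (the standard algorithm)] -/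
theorem stdScheme_elts :
    (stdScheme (matMulTensor (ZMod 2) n n n)).elts = fam (sW n) (sU n) (sV n) := by
  show stdElts _ = _
  rw [stdElts_matMulTensor]
  simp only [fam, sW, sU, sV, e_eq_single]

/-- **The candidate flips of the standard algorithm** (by `exists_update_of_flips`, reduced to the
first choice of `T` — over `ℤ₂` the second choice on `(i, j)` is the first on `(j, i)`): slot `s`
of the shared factor, positions `i, j`. [cite: KauersMoosbauer2022FlipGraphs, Def. 4] -/
def candFam (c : Fin 3 × Idx n × Idx n) : Fam3 n :=
  if c.1 = 0 then
    (sW n, upd n (sU n) c.2.2 (sU n c.2.2 - sU n c.2.1), upd n (sV n) c.2.1 (sV n c.2.1 + sV n c.2.2))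
  else if c.1 = 1 then
    (upd n (sW n) c.2.2 (sW n c.2.2 - sW n c.2.1), sU n, upd n (sV n) c.2.1 (sV n c.2.1 + sV n c.2.2))
  else
    (upd n (sW n) c.2.1 (sW n c.2.1 + sW n c.2.2), upd n (sU n) c.2.2 (sU n c.2.2 - sU n c.2.1), sV n)

/-- The shared-factor condition of a candidate. [cite: KauersMoosbauer2022FlipGraphs, Def. 4] -/
def Shared (c : Fin 3 × Idx n × Idx n) : Prop :=
  if c.1 = 0 then sW n c.2.1 = sW n c.2.2
  else if c.1 = 1 then sU n c.2.1 = sU n c.2.2 else sV n c.2.1 = sV n c.2.2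

/-- `Shared` is decidable. [cite: KauersMoosbauer2022FlipGraphs, Def. 4] -/
instance (c : Fin 3 × Idx n × Idx n) : Decidable (Shared n c) := by
  unfold Shared; infer_instance

/-- Over `ℤ₂`, `x − y = x + y` in the factor space. [folklore] -/
private theorem sub_eq_add' (x y : F n) : x - y = x + y := by
  funext q
  simp only [Pi.sub_apply, Pi.add_apply]
  generalize x q = a, y q = b
  revert a b
  decide

/-- **Every flip of the standard algorithm over `ℤ₂` is a candidate.**
[cite: KauersMoosbauer2022FlipGraphs, Def. 4 (with §4, `K = ℤ₂`)] -/
theorem exists_cand_of_flips (hne : ∀ s, sW n s ≠ 0 ∧ sU n s ≠ 0 ∧ sV n s ≠ 0)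
    (hfi : ∀ s s', sW n s = sW n s' → sU n s = sU n s' → sV n s = sV n s' → s = s')
    {S' : Multiset ((Fin n × Fin n) → (Fin n × Fin n) → (Fin n × Fin n) → ZMod 2)}
    (h : Flips (fam (sW n) (sU n) (sV n)) S') :
    ∃ c : Fin 3 × Idx n × Idx n, c.2.1 ≠ c.2.2 ∧ Shared n c ∧ S' = fam3 n (candFam n c) := by
  have hK : ∀ x : ZMod 2, x = 0 ∨ x = 1 := by decide
  have h0 := fun s => triad_ne_zero_of_ne (hne s).1 (hne s).2.1 (hne s).2.2
  obtain ⟨i, j, hij, hc⟩ :=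
    exists_update_of_flips hK h0 (triad_ne_triad_of_factors hK h0 hfi) h
  simp only [update_eq_upd] at hc
  rcases hc with ⟨hw, h | h⟩ | ⟨hu, h | h⟩ | ⟨hv, h | h⟩
  · exact ⟨(0, i, j), hij, by simpa [Shared] using hw, by simpa [fam3, candFam] using h⟩
  · refine ⟨(0, j, i), hij.symm, by simpa [Shared] using hw.symm, ?_⟩
    rw [h, sub_eq_add', ← sub_eq_add' n (sU n i)]; simp [fam3, candFam]
  · exact ⟨(1, i, j), hij, by simpa [Shared] using hu, by simpa [fam3, candFam] using h⟩
  · refine ⟨(1, j, i), hij.symm, by simpa [Shared] using hu.symm, ?_⟩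
    rw [h, sub_eq_add', ← sub_eq_add' n (sW n i)]; simp [fam3, candFam]
  · exact ⟨(2, i, j), hij, by simpa [Shared] using hv, by simpa [fam3, candFam] using h⟩
  · refine ⟨(2, j, i), hij.symm, by simpa [Shared] using hv.symm, ?_⟩
    rw [h, sub_eq_add', ← sub_eq_add' n (sU n i)]; simp [fam3, candFam]

/-- **Conversely every valid candidate is a flip of the standard algorithm.**
[cite: KauersMoosbauer2022FlipGraphs, Def. 4] -/
theorem flips_of_cand (c : Fin 3 × Idx n × Idx n) (hij : c.2.1 ≠ c.2.2)
    (hsh : Shared n c) : Flips (fam (sW n) (sU n) (sV n)) (fam3 n (candFam n c)) := by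
  obtain ⟨s, i, j⟩ := c
  simp only at hij
  fin_cases s
  · replace hsh : sW n i = sW n j := by simpa [Shared] using hsh
    exact Or.inl (by simpa [fam3, candFam, update_eq_upd] using
      flipBase_fam_update₁ (w := sW n) (u := sU n) (v := sV n) hij hsh)
  · replace hsh : sU n i = sU n j := by simpa [Shared] using hsh
    refine Or.inr (Or.inl ?_)
    rw [fam_map_sw₁₂' (sW n) (sU n) (sV n)]
    simpa [fam3, candFam, fam_map_sw₁₂', update_eq_upd] using
      flipBase_fam_update₁ (w := sU n) (u := sW n) (v := sV n) hij hsh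
  · replace hsh : sV n i = sV n j := by simpa [Shared] using hsh
    refine Or.inr (Or.inr ?_)
    rw [fam_map_sw₁₃' (sW n) (sU n) (sV n)]
    simpa [fam3, candFam, fam_map_sw₁₃', update_eq_upd] using
      flipBase_fam_update₁ (w := sV n) (u := sU n) (v := sW n) hij hsh

/-! ### The action of the witnesses on factor triples -/

/-- Relabelling of a factor triple by `(π, σ, ρ)` (the permutation sandwich, `relabelSym_triad`).
[cite: KauersMoosbauer2022FlipGraphs, §2 (symmetry group)] -/
def relabelF (π σ ρ : Equiv.Perm (Fin n)) (t : F n × F n × F n) : F n × F n × F n :=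
  (fun p => t.1 (π p.1, ρ p.2), fun p => t.2.1 (π p.1, σ p.2), fun p => t.2.2 (σ p.1, ρ p.2))

/-- The cyclic shift on a factor triple (`cycleMap_triad`): `(z, x, y) ↦ (xᵀ, y, zᵀ)`.
[cite: KauersMoosbauer2022FlipGraphs, §2 (symmetry group)] -/
def cycleF (t : F n × F n × F n) : F n × F n × F n :=
  (fun p => t.2.1 p.swap, t.2.2, fun p => t.1 p.swap)

/-- `k` cyclic shifts on a factor triple. [cite: KauersMoosbauer2022FlipGraphs, §2] -/
def cycPowF (k : Fin 3) (t : F n × F n × F n) : F n × F n × F n :=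
  if k = 0 then t else if k = 1 then cycleF n t else cycleF n (cycleF n t)

/-- The action of a witness on a factor triple: relabel, then shift.
[cite: KauersMoosbauer2022FlipGraphs, §2 (symmetry group)] -/
def actF (ω : Wit n) (t : F n × F n × F n) : F n × F n × F n :=
  cycPowF n ω.1 (relabelF n ω.2.1 ω.2.2.1 ω.2.2.2 t)

/-- The action of a witness on a triple of families (memberwise).
[cite: KauersMoosbauer2022FlipGraphs, §2 (symmetry group)] -/
def actFam (ω : Wit n) (Φ : Fam3 n) : Fam3 n :=
  (fun s => (actF n ω (Φ.1 s, Φ.2.1 s, Φ.2.2 s)).1,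
   fun s => (actF n ω (Φ.1 s, Φ.2.1 s, Φ.2.2 s)).2.1,
   fun s => (actF n ω (Φ.1 s, Φ.2.1 s, Φ.2.2 s)).2.2)

/-- `k` cyclic shifts as an element of `G`. [cite: KauersMoosbauer2022FlipGraphs, §2] -/
noncomputable def cycPowSym (k : Fin 3) : Symmetry (matMulTensor (ZMod 2) n n n) :=
  if k = 0 then Symmetry.refl _
  else if k = 1 then Symmetry.cycleSq n else (Symmetry.cycleSq n).trans (Symmetry.cycleSq n)

/-- The group element denoted by a witness: the permutation sandwich followed by the shifts.
[cite: KauersMoosbauer2022FlipGraphs, §2 (symmetry group)] -/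
noncomputable def symOf (ω : Wit n) : Symmetry (matMulTensor (ZMod 2) n n n) :=
  (relabelSym ω.2.1 ω.2.2.1 ω.2.2.2).trans (cycPowSym n ω.1)

/-- It belongs to KM's group `G`. [cite: KauersMoosbauer2022FlipGraphs, §2 (symmetry group)] -/
theorem inSymmetryGroup_symOf (ω : Wit n) : InSymmetryGroup (symOf n ω) := by
  refine (inSymmetryGroup_relabelSym _ _ _).trans ?_
  unfold cycPowSym
  split_ifs
  · exact InSymmetryGroup.refl
  · exact InSymmetryGroup.cycle
  · exact InSymmetryGroup.cycle.trans InSymmetryGroup.cycle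

/-- The shifts act on rank-one tensors as `cycPowF` on their factors.
[cite: KauersMoosbauer2022FlipGraphs, §2 (symmetry group)] -/
theorem cycPowSym_triad (k : Fin 3) (t : F n × F n × F n) :
    (cycPowSym n k).toLinearEquiv (triad t.1 t.2.1 t.2.2) =
      triad (cycPowF n k t).1 (cycPowF n k t).2.1 (cycPowF n k t).2.2 := by
  unfold cycPowSym cycPowF
  split_ifs
  · rfl
  · exact cycleSq_triad _ _ _
  · simp only [Symmetry.trans, LinearEquiv.trans_apply, cycleSq_triad]
    rfl

/-- A witness acts on rank-one tensors as `actF` on their factors.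
[cite: KauersMoosbauer2022FlipGraphs, §2 (symmetry group)] -/
theorem symOf_triad (ω : Wit n) (t : F n × F n × F n) :
    (symOf n ω).toLinearEquiv (triad t.1 t.2.1 t.2.2) =
      triad (actF n ω t).1 (actF n ω t).2.1 (actF n ω t).2.2 := by
  show (cycPowSym n ω.1).toLinearEquiv ((relabelSym ω.2.1 ω.2.2.1 ω.2.2.2).toLinearEquiv _) = _
  rw [relabelSym_triad]
  exact cycPowSym_triad n ω.1 (relabelF n ω.2.1 ω.2.2.1 ω.2.2.2 t)

/-- Hence a witness maps the scheme of a family triple to the scheme of the acted triple.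
[cite: KauersMoosbauer2022FlipGraphs, §2 (symmetry group)] -/
theorem fam3_map_symOf (ω : Wit n) (Φ : Fam3 n) :
    (fam3 n Φ).map (symOf n ω).toLinearEquiv = fam3 n (actFam n ω Φ) := by
  simp only [fam3, fam, actFam, Multiset.map_map, Function.comp_def]
  exact Multiset.map_congr rfl fun s _ => symOf_triad n ω (Φ.1 s, Φ.2.1 s, Φ.2.2 s)

/-- Families with the same multiset of factor triples present the same scheme.
[cite: KauersMoosbauer2022FlipGraphs, Def. 1] -/
theorem fam3_eq_of_tms_eq {Φ Ψ : Fam3 n} (h : tms n Φ = tms n Ψ) : fam3 n Φ = fam3 n Ψ := by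
  have e : ∀ Θ : Fam3 n, fam3 n Θ = (tms n Θ).map fun t => triad t.1 t.2.1 t.2.2 := fun Θ => by
    simp only [fam3, fam, tms, Multiset.map_map, Function.comp_def]
  rw [e, e, h]

/-- The index relabelling induced by a witness on the standard algorithm's products: the
permutation sandwich `(π, σ, ρ)` sends the product `(κ, μ, ν)` to `(π⁻¹κ, σ⁻¹μ, ρ⁻¹ν)`.
[cite: KauersMoosbauer2022FlipGraphs, §2 (symmetry group)] -/
def idxRelabel (π σ ρ : Equiv.Perm (Fin n)) : Idx n ≃ Idx n :=
  Equiv.prodCongr π.symm (Equiv.prodCongr σ.symm ρ.symm)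

/-- … and the cyclic shift sends the product `(κ, μ, ν)` to `(μ, ν, κ)`.
[cite: KauersMoosbauer2022FlipGraphs, §2 (symmetry group)] -/
def idxCycle : Idx n ≃ Idx n where
  toFun p := (p.2.1, p.2.2, p.1)
  invFun p := (p.2.2, p.1, p.2.1)
  left_inv _ := rfl
  right_inv _ := rfl

/-- `k` cyclic shifts on indices. [cite: KauersMoosbauer2022FlipGraphs, §2 (symmetry group)] -/
def idxCycPow (k : Fin 3) : Idx n ≃ Idx n :=
  if k = 0 then Equiv.refl _ else if k = 1 then idxCycle n else (idxCycle n).trans (idxCycle n)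

/-- The index relabelling induced by a witness. [cite: KauersMoosbauer2022FlipGraphs, §2 (symmetry group)] -/
def idxEquiv (ω : Wit n) : Idx n ≃ Idx n :=
  (idxRelabel n ω.2.1 ω.2.2.1 ω.2.2.2).trans (idxCycPow n ω.1)

/-- The factor triple of member `s` of a triple of families. [cite: KauersMoosbauer2022FlipGraphs, Def. 1] -/
def trip (Φ : Fam3 n) (s : Idx n) : F n × F n × F n := (Φ.1 s, Φ.2.1 s, Φ.2.2 s)

/-- **Pointwise agreement along an index bijection gives equal multisets of factor triples**: if
member `g s` of `Φ` is the image under the witness `ω` of member `s` of `Ψ` for every `s`, then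
`tms Φ = tms (ω · Ψ)`. [cite: KauersMoosbauer2022FlipGraphs, §2 (symmetry group)] -/
theorem tms_eq_of_pointwise (ω : Wit n) (g : Idx n ≃ Idx n) {Φ Ψ : Fam3 n}
    (h : ∀ s, trip n Φ (g s) = actF n ω (trip n Ψ s)) : tms n Φ = tms n (actFam n ω Ψ) := by
  have e : tms n (actFam n ω Ψ) = (Finset.univ : Finset (Idx n)).val.map fun s => trip n Φ (g s) := by
    simp only [tms, actFam]
    exact Multiset.map_congr rfl fun s _ => (h s).symm
  have hu : (Finset.univ : Finset (Idx n)).val.map ⇑g = Finset.univ.val := by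
    rw [← Equiv.coe_toEmbedding, ← Finset.map_val, Finset.map_univ_equiv]
  rw [e, show (fun s => trip n Φ (g s)) = trip n Φ ∘ ⇑g from rfl, ← Multiset.map_map, hu]
  rfl

/-- The reference neighbour `N₀`: the candidate `(Z shared, i₀ = (0,0,0), j₀ = (0,1,0))`, i.e. the
standard algorithm with `e₀₀⊗e₀₀⊗e₀₀, e₀₀⊗e₀₁⊗e₁₀` replaced by `e₀₀⊗e₀₀⊗(e₀₀+e₁₀),
e₀₀⊗(e₀₁−e₀₀)⊗e₁₀`. [cite: KauersMoosbauer2022FlipGraphs, §4 ("only one neighbor")] -/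
def c₀ [NeZero n] : Fin 3 × Idx n × Idx n := (0, (0, 0, 0), (0, 1, 0))

/-! ### Assembly, for a general `n`, from finitely many checkable facts -/

section Assembly

variable {n} [NeZero n]

/-- The hypotheses checked by `decide` for `n = 2, 3` below: non-zero factors, injectivity of the
factor triples, the six separation properties (irreducibility), validity of `c₀` and non-vanishing
of `N₀`'s factors, and — the heart — every valid candidate has the same factor triples as the image
of `N₀` under its witness. [cite: KauersMoosbauer2022FlipGraphs, §4] -/
structure Checks (wit : Fin 3 × Idx n × Idx n → Wit n) : Prop where
  ne : ∀ s, sW n s ≠ 0 ∧ sU n s ≠ 0 ∧ sV n s ≠ 0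
  inj : ∀ s s', sW n s = sW n s' → sU n s = sU n s' → sV n s = sV n s' → s = s'
  sep_wu : ∀ t, ∃ x, sU n t x ≠ 0 ∧ ∀ i, i ≠ t → sW n i = sW n t → sU n i x = 0
  sep_wv : ∀ t, ∃ x, sV n t x ≠ 0 ∧ ∀ i, i ≠ t → sW n i = sW n t → sV n i x = 0
  sep_uw : ∀ t, ∃ x, sW n t x ≠ 0 ∧ ∀ i, i ≠ t → sU n i = sU n t → sW n i x = 0
  sep_uv : ∀ t, ∃ x, sV n t x ≠ 0 ∧ ∀ i, i ≠ t → sU n i = sU n t → sV n i x = 0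
  sep_vw : ∀ t, ∃ x, sW n t x ≠ 0 ∧ ∀ i, i ≠ t → sV n i = sV n t → sW n i x = 0
  sep_vu : ∀ t, ∃ x, sU n t x ≠ 0 ∧ ∀ i, i ≠ t → sV n i = sV n t → sU n i x = 0
  c₀_ne : (c₀ n).2.1 ≠ (c₀ n).2.2
  c₀_shared : Shared n (c₀ n)
  N₀_ne : ∀ s, (candFam n (c₀ n)).1 s ≠ 0 ∧ (candFam n (c₀ n)).2.1 s ≠ 0 ∧
    (candFam n (c₀ n)).2.2 s ≠ 0
  key : ∀ c : Fin 3 × Idx n × Idx n, c.2.1 ≠ c.2.2 → Shared n c →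
    ∀ s, trip n (candFam n c) (idxEquiv n (wit c) s) = actF n (wit c) (trip n (candFam n (c₀ n)) s)

variable {wit : Fin 3 × Idx n × Idx n → Wit n}

/-- `N₀` is a flip of the standard algorithm. [cite: KauersMoosbauer2022FlipGraphs, §4, Def. 4] -/
theorem flips_std_N₀ (H : Checks wit) :
    Flips (stdScheme (matMulTensor (ZMod 2) n n n)).elts (fam3 n (candFam n (c₀ n))) := by
  rw [stdScheme_elts]
  exact flips_of_cand n (c₀ n) H.c₀_ne H.c₀_shared

/-- **`N₀` as a vertex of the flip graph** (a scheme of `⟨n,n,n⟩` over `ℤ₂`: its sum is that of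
the standard algorithm since it is a flip of it). [cite: KauersMoosbauer2022FlipGraphs, §4, Def. 1] -/
def N₀ (H : Checks wit) : Scheme (matMulTensor (ZMod 2) n n n) where
  elts := fam3 n (candFam n (c₀ n))
  ne_zero T hT := by
    obtain ⟨s, rfl⟩ := mem_fam.mp hT
    exact triad_ne_zero_of_ne (H.N₀_ne s).1 (H.N₀_ne s).2.1 (H.N₀_ne s).2.2
  exists_triad T hT := by
    obtain ⟨s, rfl⟩ := mem_fam.mp hT
    exact ⟨_, _, _, rfl⟩
  sum_eq := by
    rw [show fam3 n (candFam n (c₀ n)) = _ from rfl, (flips_std_N₀ H).sum_eq]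
    exact (stdScheme _).sum_eq

/-- Its elements. [cite: KauersMoosbauer2022FlipGraphs, §4] -/
theorem N₀_elts (H : Checks wit) : (N₀ H).elts = fam3 n (candFam n (c₀ n)) := rfl

/-- Its rank is `n³` (a flip keeps the level). [cite: KauersMoosbauer2022FlipGraphs, §4, Def. 8] -/
theorem rank_N₀ (H : Checks wit) : (N₀ H).rank = n * n * n := by
  rw [Scheme.rank, N₀_elts, (flips_std_N₀ H).card_eq]
  exact rank_stdScheme_matMulTensor n n n

/-- `N₀` is adjacent from the standard algorithm (an `E₁` edge).
[cite: KauersMoosbauer2022FlipGraphs, §4, Def. 8] -/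
theorem adj_std_N₀ (H : Checks wit) : Adj (stdScheme (matMulTensor (ZMod 2) n n n)) (N₀ H) :=
  Or.inl (flips_std_N₀ H)

omit [NeZero n] in
/-- Two schemes with the same elements are equal. [folklore] -/
private theorem scheme_ext {t : (Fin n × Fin n) → (Fin n × Fin n) → (Fin n × Fin n) → ZMod 2}
    {x y : Scheme t} (h : x.elts = y.elts) : x = y := by
  cases x; cases y; cases h; rfl

/-- **The standard algorithm is irreducible over `ℤ₂`** (no `E₂` edge leaves it).
[cite: KauersMoosbauer2022FlipGraphs, §4 ("None of them is reducible"), Def. 2, Prop. 3] -/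
theorem not_reduces_std (H : Checks wit)
    (S' : Multiset ((Fin n × Fin n) → (Fin n × Fin n) → (Fin n × Fin n) → ZMod 2)) :
    ¬ Reduces (stdScheme (matMulTensor (ZMod 2) n n n)).elts S' := by
  rw [stdScheme_elts]
  exact not_reduces_fam_of_sep (by decide) H.ne H.inj H.sep_wu H.sep_wv H.sep_uw H.sep_uv
    H.sep_vw H.sep_vu S'

/-- **Every neighbour of the standard algorithm is equivalent to `N₀`** under KM's group `G`.
[cite: KauersMoosbauer2022FlipGraphs, §4 ("any two schemes obtained by a flip from the standard
algorithm are equivalent")] -/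
theorem equiv_N₀_of_adj (H : Checks wit) {y : Scheme (matMulTensor (ZMod 2) n n n)}
    (h : Adj (stdScheme (matMulTensor (ZMod 2) n n n)) y) :
    (orbitSetoidKM (ZMod 2) n).r (N₀ H) y := by
  rcases h with h | h
  · rw [stdScheme_elts] at h
    obtain ⟨c, hij, hsh, hy⟩ := exists_cand_of_flips n H.ne H.inj h
    refine ⟨symOf n (wit c), inSymmetryGroup_symOf n (wit c), scheme_ext ?_⟩
    rw [Scheme.map_elts, N₀_elts, fam3_map_symOf, hy]
    exact fam3_eq_of_tms_eq n (tms_eq_of_pointwise n (wit c) (idxEquiv n (wit c)) (H.key c hij hsh))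
  · exact absurd h (not_reduces_std H y.elts)

/-- **KM §4: "any two schemes obtained by a flip from the standard algorithm are equivalent"**
— indeed any two NEIGHBOURS (flips or reductions, Def. 8) of the standard algorithm of `⟨n,n,n⟩`
over `ℤ₂` are in one orbit of KM's symmetry group, granted the finitely many `Checks`.
[cite: KauersMoosbauer2022FlipGraphs, §4] -/
theorem std_neighbours_equivalent (H : Checks wit) {y y' : Scheme (matMulTensor (ZMod 2) n n n)}
    (h : Adj (stdScheme (matMulTensor (ZMod 2) n n n)) y)
    (h' : Adj (stdScheme (matMulTensor (ZMod 2) n n n)) y') : (orbitSetoidKM (ZMod 2) n).r y y' :=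
  (orbitSetoidKM (ZMod 2) n).iseqv.trans
    ((orbitSetoidKM (ZMod 2) n).iseqv.symm (equiv_N₀_of_adj H h)) (equiv_N₀_of_adj H h')

/-- **KM §4: "the standard algorithm … only has one neighbor"** — in KM's flip graph on orbits
(Def. 8) the out-neighbours of the orbit of the standard algorithm are exactly the orbit of `N₀`,
granted the `Checks`. [cite: KauersMoosbauer2022FlipGraphs, §4, Def. 8] -/
theorem std_one_neighbour (H : Checks wit) (q : Quotient (orbitSetoidKM (ZMod 2) n)) :
    flipGraphKM (ZMod 2) n (Quotient.mk _ (stdScheme (matMulTensor (ZMod 2) n n n))) q ↔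
      q = Quotient.mk _ (N₀ H) := by
  induction q using Quotient.inductionOn with
  | h y =>
    rw [flipGraphKM_mk_iff]
    constructor
    · rintro ⟨y', hyy', hadj⟩
      exact Quotient.sound ((orbitSetoidKM (ZMod 2) n).iseqv.trans hyy'
        ((orbitSetoidKM (ZMod 2) n).iseqv.symm (equiv_N₀_of_adj H hadj)))
    · intro hq
      exact ⟨N₀ H, Quotient.exact hq, adj_std_N₀ H⟩

/-- **`N₀` is not equivalent to the standard algorithm** (so the one neighbour is a genuinely
different vertex): the standard algorithm has no lonely factor while `N₀` has one, and the property
is `G`-invariant — granted the two factor-level facts, checked by `decide` below.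
[cite: KauersMoosbauer2022FlipGraphs, §4 ("only one neighbor")] -/
theorem N₀_not_equiv_std (H : Checks wit) (hstd : ¬ LonelyFam (sW n) (sU n) (sV n))
    (hN : LonelyFam (candFam n (c₀ n)).1 (candFam n (c₀ n)).2.1 (candFam n (c₀ n)).2.2)
    (hNinj : ∀ s s', (candFam n (c₀ n)).1 s = (candFam n (c₀ n)).1 s' →
      (candFam n (c₀ n)).2.1 s = (candFam n (c₀ n)).2.1 s' →
      (candFam n (c₀ n)).2.2 s = (candFam n (c₀ n)).2.2 s' → s = s') :
    ¬ (orbitSetoidKM (ZMod 2) n).r (stdScheme (matMulTensor (ZMod 2) n n n)) (N₀ H) := by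
  have hK : ∀ x : ZMod 2, x = 0 ∨ x = 1 := by decide
  intro h
  have hN' : Lonely (N₀ H).elts := by
    rw [N₀_elts]
    exact lonely_of_lonelyFam hK
      (fun s => triad_ne_zero_of_ne (H.N₀_ne s).1 (H.N₀_ne s).2.1 (H.N₀_ne s).2.2)
      (triad_ne_triad_of_factors hK
        (fun s => triad_ne_zero_of_ne (H.N₀_ne s).1 (H.N₀_ne s).2.1 (H.N₀_ne s).2.2) hNinj) hN
  have hstd' : Lonely (stdScheme (matMulTensor (ZMod 2) n n n)).elts := (lonely_iff_of_equiv h).2 hN'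
  rw [stdScheme_elts] at hstd'
  exact hstd (lonelyFam_of_lonely (triad_ne_triad_of_factors hK
    (fun s => triad_ne_zero_of_ne (H.ne s).1 (H.ne s).2.1 (H.ne s).2.2) H.inj) hstd')

/-- … so in KM's flip graph on orbits the unique out-neighbour of the standard algorithm's orbit is
a different vertex. [cite: KauersMoosbauer2022FlipGraphs, §4, Def. 8] -/
theorem N₀_orbit_ne_std (H : Checks wit) (hstd : ¬ LonelyFam (sW n) (sU n) (sV n))
    (hN : LonelyFam (candFam n (c₀ n)).1 (candFam n (c₀ n)).2.1 (candFam n (c₀ n)).2.2)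
    (hNinj : ∀ s s', (candFam n (c₀ n)).1 s = (candFam n (c₀ n)).1 s' →
      (candFam n (c₀ n)).2.1 s = (candFam n (c₀ n)).2.1 s' →
      (candFam n (c₀ n)).2.2 s = (candFam n (c₀ n)).2.2 s' → s = s') :
    (Quotient.mk (orbitSetoidKM (ZMod 2) n) (N₀ H)) ≠
      Quotient.mk _ (stdScheme (matMulTensor (ZMod 2) n n n)) := fun e =>
  N₀_not_equiv_std H hstd hN hNinj (Quotient.exact e.symm)

end Assembly

/-! ## §4 The checks for `n = 2` and `n = 3` (kernel evaluation) and KM's two sentences -/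

/-- The transposition `(0 1)` of `Fin 2`. [folklore] -/
def τ₀₁' : Equiv.Perm (Fin 2) := Equiv.swap 0 1

/-- The witnesses for `⟨2,2,2⟩`: for each valid candidate `(s, i, j)` the number of cyclic shifts
and the permutation sandwich `(π, σ, ρ)` carrying `N₀` to it (found by a search of ours; checked by
the kernel in `checks₂`). [cite: KauersMoosbauer2022FlipGraphs, §4 ((2,2,2): "only has one neighbor")] -/
def witTab₂ : List ((Fin 3 × Idx 2 × Idx 2) × Wit 2) :=
  [((0, (0, 0, 0), (0, 1, 0)), (0, 1, 1, 1)),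
   ((0, (0, 0, 1), (0, 1, 1)), (0, 1, 1, τ₀₁')),
   ((0, (0, 1, 0), (0, 0, 0)), (0, 1, τ₀₁', 1)),
   ((0, (0, 1, 1), (0, 0, 1)), (0, 1, τ₀₁', τ₀₁')),
   ((0, (1, 0, 0), (1, 1, 0)), (0, τ₀₁', 1, 1)),
   ((0, (1, 0, 1), (1, 1, 1)), (0, τ₀₁', 1, τ₀₁')),
   ((0, (1, 1, 0), (1, 0, 0)), (0, τ₀₁', τ₀₁', 1)),
   ((0, (1, 1, 1), (1, 0, 1)), (0, τ₀₁', τ₀₁', τ₀₁')),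
   ((1, (0, 0, 0), (0, 0, 1)), (2, 1, τ₀₁', 1)),
   ((1, (0, 0, 1), (0, 0, 0)), (2, 1, 1, 1)),
   ((1, (0, 1, 0), (0, 1, 1)), (2, τ₀₁', τ₀₁', 1)),
   ((1, (0, 1, 1), (0, 1, 0)), (2, τ₀₁', 1, 1)),
   ((1, (1, 0, 0), (1, 0, 1)), (2, 1, τ₀₁', τ₀₁')),
   ((1, (1, 0, 1), (1, 0, 0)), (2, 1, 1, τ₀₁')),
   ((1, (1, 1, 0), (1, 1, 1)), (2, τ₀₁', τ₀₁', τ₀₁')),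
   ((1, (1, 1, 1), (1, 1, 0)), (2, τ₀₁', 1, τ₀₁')),
   ((2, (0, 0, 0), (1, 0, 0)), (1, 1, τ₀₁', 1)),
   ((2, (0, 0, 1), (1, 0, 1)), (1, τ₀₁', τ₀₁', 1)),
   ((2, (0, 1, 0), (1, 1, 0)), (1, 1, τ₀₁', τ₀₁')),
   ((2, (0, 1, 1), (1, 1, 1)), (1, τ₀₁', τ₀₁', τ₀₁')),
   ((2, (1, 0, 0), (0, 0, 0)), (1, 1, 1, 1)),
   ((2, (1, 0, 1), (0, 0, 1)), (1, τ₀₁', 1, 1)),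
   ((2, (1, 1, 0), (0, 1, 0)), (1, 1, 1, τ₀₁')),
   ((2, (1, 1, 1), (0, 1, 1)), (1, τ₀₁', 1, τ₀₁'))]

/-- The witness map for `⟨2,2,2⟩` (table lookup). [cite: KauersMoosbauer2022FlipGraphs, §4] -/
def wit₂ (c : Fin 3 × Idx 2 × Idx 2) : Wit 2 := (witTab₂.lookup c).getD (0, 1, 1, 1)

set_option synthInstance.maxSize 8192 in
set_option maxHeartbeats 0 in
/-- **The checks for `⟨2,2,2⟩` over `ℤ₂`** (kernel evaluation; `24` valid candidates).
[cite: KauersMoosbauer2022FlipGraphs, §4 ((2,2,2): "only has one neighbor")] -/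
theorem checks₂ : Checks (n := 2) wit₂ where
  ne := by decide +kernel
  inj := by decide +kernel
  sep_wu := by decide +kernel
  sep_wv := by decide +kernel
  sep_uw := by decide +kernel
  sep_uv := by decide +kernel
  sep_vw := by decide +kernel
  sep_vu := by decide +kernel
  c₀_ne := by decide +kernel
  c₀_shared := by decide +kernel
  N₀_ne := by decide +kernel
  key := by decide +kernel

/-- The transposition `(0 1)` of `Fin 3`. [folklore] -/
def τ₀₁ : Equiv.Perm (Fin 3) := Equiv.swap 0 1
/-- The transposition `(0 2)` of `Fin 3`. [folklore] -/
def τ₀₂ : Equiv.Perm (Fin 3) := Equiv.swap 0 2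
/-- The transposition `(1 2)` of `Fin 3`. [folklore] -/
def τ₁₂ : Equiv.Perm (Fin 3) := Equiv.swap 1 2
/-- The `3`-cycle `0 ↦ 1 ↦ 2 ↦ 0`. [folklore] -/
def ρ₁₂₀ : Equiv.Perm (Fin 3) := Equiv.swap 0 1 * Equiv.swap 1 2
/-- The `3`-cycle `0 ↦ 2 ↦ 1 ↦ 0`. [folklore] -/
def ρ₂₀₁ : Equiv.Perm (Fin 3) := Equiv.swap 1 2 * Equiv.swap 0 1

/-- The witnesses for `⟨3,3,3⟩`, shared factor in slot `1` (`54` candidates): the number of cyclic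
shifts and the permutation sandwich `(π, σ, ρ)` carrying `N₀` to the candidate (found by a search of ours;
checked by the kernel below). [cite: KauersMoosbauer2022FlipGraphs, §4 ((3,3,3): "only one neighbor")] -/
def witTab₃_0 : List ((Fin 3 × Idx 3 × Idx 3) × Wit 3) :=
  [((0, (0, 0, 0), (0, 1, 0)), (0, 1, 1, 1)),
   ((0, (0, 0, 0), (0, 2, 0)), (0, 1, τ₁₂, 1)),
   ((0, (0, 0, 1), (0, 1, 1)), (0, 1, 1, τ₀₁)),
   ((0, (0, 0, 1), (0, 2, 1)), (0, 1, τ₁₂, τ₀₁)),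
   ((0, (0, 0, 2), (0, 1, 2)), (0, 1, 1, ρ₁₂₀)),
   ((0, (0, 0, 2), (0, 2, 2)), (0, 1, τ₁₂, ρ₁₂₀)),
   ((0, (0, 1, 0), (0, 0, 0)), (0, 1, τ₀₁, 1)),
   ((0, (0, 1, 0), (0, 2, 0)), (0, 1, ρ₂₀₁, 1)),
   ((0, (0, 1, 1), (0, 0, 1)), (0, 1, τ₀₁, τ₀₁)),
   ((0, (0, 1, 1), (0, 2, 1)), (0, 1, ρ₂₀₁, τ₀₁)),
   ((0, (0, 1, 2), (0, 0, 2)), (0, 1, τ₀₁, ρ₁₂₀)),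
   ((0, (0, 1, 2), (0, 2, 2)), (0, 1, ρ₂₀₁, ρ₁₂₀)),
   ((0, (0, 2, 0), (0, 0, 0)), (0, 1, ρ₁₂₀, 1)),
   ((0, (0, 2, 0), (0, 1, 0)), (0, 1, τ₀₂, 1)),
   ((0, (0, 2, 1), (0, 0, 1)), (0, 1, ρ₁₂₀, τ₀₁)),
   ((0, (0, 2, 1), (0, 1, 1)), (0, 1, τ₀₂, τ₀₁)),
   ((0, (0, 2, 2), (0, 0, 2)), (0, 1, ρ₁₂₀, ρ₁₂₀)),
   ((0, (0, 2, 2), (0, 1, 2)), (0, 1, τ₀₂, ρ₁₂₀)),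
   ((0, (1, 0, 0), (1, 1, 0)), (0, τ₀₁, 1, 1)),
   ((0, (1, 0, 0), (1, 2, 0)), (0, τ₀₁, τ₁₂, 1)),
   ((0, (1, 0, 1), (1, 1, 1)), (0, τ₀₁, 1, τ₀₁)),
   ((0, (1, 0, 1), (1, 2, 1)), (0, τ₀₁, τ₁₂, τ₀₁)),
   ((0, (1, 0, 2), (1, 1, 2)), (0, τ₀₁, 1, ρ₁₂₀)),
   ((0, (1, 0, 2), (1, 2, 2)), (0, τ₀₁, τ₁₂, ρ₁₂₀)),
   ((0, (1, 1, 0), (1, 0, 0)), (0, τ₀₁, τ₀₁, 1)),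
   ((0, (1, 1, 0), (1, 2, 0)), (0, τ₀₁, ρ₂₀₁, 1)),
   ((0, (1, 1, 1), (1, 0, 1)), (0, τ₀₁, τ₀₁, τ₀₁)),
   ((0, (1, 1, 1), (1, 2, 1)), (0, τ₀₁, ρ₂₀₁, τ₀₁)),
   ((0, (1, 1, 2), (1, 0, 2)), (0, τ₀₁, τ₀₁, ρ₁₂₀)),
   ((0, (1, 1, 2), (1, 2, 2)), (0, τ₀₁, ρ₂₀₁, ρ₁₂₀)),
   ((0, (1, 2, 0), (1, 0, 0)), (0, τ₀₁, ρ₁₂₀, 1)),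
   ((0, (1, 2, 0), (1, 1, 0)), (0, τ₀₁, τ₀₂, 1)),
   ((0, (1, 2, 1), (1, 0, 1)), (0, τ₀₁, ρ₁₂₀, τ₀₁)),
   ((0, (1, 2, 1), (1, 1, 1)), (0, τ₀₁, τ₀₂, τ₀₁)),
   ((0, (1, 2, 2), (1, 0, 2)), (0, τ₀₁, ρ₁₂₀, ρ₁₂₀)),
   ((0, (1, 2, 2), (1, 1, 2)), (0, τ₀₁, τ₀₂, ρ₁₂₀)),
   ((0, (2, 0, 0), (2, 1, 0)), (0, ρ₁₂₀, 1, 1)),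
   ((0, (2, 0, 0), (2, 2, 0)), (0, ρ₁₂₀, τ₁₂, 1)),
   ((0, (2, 0, 1), (2, 1, 1)), (0, ρ₁₂₀, 1, τ₀₁)),
   ((0, (2, 0, 1), (2, 2, 1)), (0, ρ₁₂₀, τ₁₂, τ₀₁)),
   ((0, (2, 0, 2), (2, 1, 2)), (0, ρ₁₂₀, 1, ρ₁₂₀)),
   ((0, (2, 0, 2), (2, 2, 2)), (0, ρ₁₂₀, τ₁₂, ρ₁₂₀)),
   ((0, (2, 1, 0), (2, 0, 0)), (0, ρ₁₂₀, τ₀₁, 1)),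
   ((0, (2, 1, 0), (2, 2, 0)), (0, ρ₁₂₀, ρ₂₀₁, 1)),
   ((0, (2, 1, 1), (2, 0, 1)), (0, ρ₁₂₀, τ₀₁, τ₀₁)),
   ((0, (2, 1, 1), (2, 2, 1)), (0, ρ₁₂₀, ρ₂₀₁, τ₀₁)),
   ((0, (2, 1, 2), (2, 0, 2)), (0, ρ₁₂₀, τ₀₁, ρ₁₂₀)),
   ((0, (2, 1, 2), (2, 2, 2)), (0, ρ₁₂₀, ρ₂₀₁, ρ₁₂₀)),
   ((0, (2, 2, 0), (2, 0, 0)), (0, ρ₁₂₀, ρ₁₂₀, 1)),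
   ((0, (2, 2, 0), (2, 1, 0)), (0, ρ₁₂₀, τ₀₂, 1)),
   ((0, (2, 2, 1), (2, 0, 1)), (0, ρ₁₂₀, ρ₁₂₀, τ₀₁)),
   ((0, (2, 2, 1), (2, 1, 1)), (0, ρ₁₂₀, τ₀₂, τ₀₁)),
   ((0, (2, 2, 2), (2, 0, 2)), (0, ρ₁₂₀, ρ₁₂₀, ρ₁₂₀)),
   ((0, (2, 2, 2), (2, 1, 2)), (0, ρ₁₂₀, τ₀₂, ρ₁₂₀))]

/-- The witnesses for `⟨3,3,3⟩`, shared factor in slot `2` (`54` candidates): the number of cyclic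
shifts and the permutation sandwich `(π, σ, ρ)` carrying `N₀` to the candidate (found by a search of ours;
checked by the kernel below). [cite: KauersMoosbauer2022FlipGraphs, §4 ((3,3,3): "only one neighbor")] -/
def witTab₃_1 : List ((Fin 3 × Idx 3 × Idx 3) × Wit 3) :=
  [((1, (0, 0, 0), (0, 0, 1)), (2, 1, τ₀₁, 1)),
   ((1, (0, 0, 0), (0, 0, 2)), (2, 1, ρ₁₂₀, 1)),
   ((1, (0, 0, 1), (0, 0, 0)), (2, 1, 1, 1)),
   ((1, (0, 0, 1), (0, 0, 2)), (2, 1, τ₀₂, 1)),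
   ((1, (0, 0, 2), (0, 0, 0)), (2, 1, τ₁₂, 1)),
   ((1, (0, 0, 2), (0, 0, 1)), (2, 1, ρ₂₀₁, 1)),
   ((1, (0, 1, 0), (0, 1, 1)), (2, τ₀₁, τ₀₁, 1)),
   ((1, (0, 1, 0), (0, 1, 2)), (2, τ₀₁, ρ₁₂₀, 1)),
   ((1, (0, 1, 1), (0, 1, 0)), (2, τ₀₁, 1, 1)),
   ((1, (0, 1, 1), (0, 1, 2)), (2, τ₀₁, τ₀₂, 1)),
   ((1, (0, 1, 2), (0, 1, 0)), (2, τ₀₁, τ₁₂, 1)),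
   ((1, (0, 1, 2), (0, 1, 1)), (2, τ₀₁, ρ₂₀₁, 1)),
   ((1, (0, 2, 0), (0, 2, 1)), (2, ρ₁₂₀, τ₀₁, 1)),
   ((1, (0, 2, 0), (0, 2, 2)), (2, ρ₁₂₀, ρ₁₂₀, 1)),
   ((1, (0, 2, 1), (0, 2, 0)), (2, ρ₁₂₀, 1, 1)),
   ((1, (0, 2, 1), (0, 2, 2)), (2, ρ₁₂₀, τ₀₂, 1)),
   ((1, (0, 2, 2), (0, 2, 0)), (2, ρ₁₂₀, τ₁₂, 1)),
   ((1, (0, 2, 2), (0, 2, 1)), (2, ρ₁₂₀, ρ₂₀₁, 1)),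
   ((1, (1, 0, 0), (1, 0, 1)), (2, 1, τ₀₁, τ₀₁)),
   ((1, (1, 0, 0), (1, 0, 2)), (2, 1, ρ₁₂₀, τ₀₁)),
   ((1, (1, 0, 1), (1, 0, 0)), (2, 1, 1, τ₀₁)),
   ((1, (1, 0, 1), (1, 0, 2)), (2, 1, τ₀₂, τ₀₁)),
   ((1, (1, 0, 2), (1, 0, 0)), (2, 1, τ₁₂, τ₀₁)),
   ((1, (1, 0, 2), (1, 0, 1)), (2, 1, ρ₂₀₁, τ₀₁)),
   ((1, (1, 1, 0), (1, 1, 1)), (2, τ₀₁, τ₀₁, τ₀₁)),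
   ((1, (1, 1, 0), (1, 1, 2)), (2, τ₀₁, ρ₁₂₀, τ₀₁)),
   ((1, (1, 1, 1), (1, 1, 0)), (2, τ₀₁, 1, τ₀₁)),
   ((1, (1, 1, 1), (1, 1, 2)), (2, τ₀₁, τ₀₂, τ₀₁)),
   ((1, (1, 1, 2), (1, 1, 0)), (2, τ₀₁, τ₁₂, τ₀₁)),
   ((1, (1, 1, 2), (1, 1, 1)), (2, τ₀₁, ρ₂₀₁, τ₀₁)),
   ((1, (1, 2, 0), (1, 2, 1)), (2, ρ₁₂₀, τ₀₁, τ₀₁)),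
   ((1, (1, 2, 0), (1, 2, 2)), (2, ρ₁₂₀, ρ₁₂₀, τ₀₁)),
   ((1, (1, 2, 1), (1, 2, 0)), (2, ρ₁₂₀, 1, τ₀₁)),
   ((1, (1, 2, 1), (1, 2, 2)), (2, ρ₁₂₀, τ₀₂, τ₀₁)),
   ((1, (1, 2, 2), (1, 2, 0)), (2, ρ₁₂₀, τ₁₂, τ₀₁)),
   ((1, (1, 2, 2), (1, 2, 1)), (2, ρ₁₂₀, ρ₂₀₁, τ₀₁)),
   ((1, (2, 0, 0), (2, 0, 1)), (2, 1, τ₀₁, ρ₁₂₀)),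
   ((1, (2, 0, 0), (2, 0, 2)), (2, 1, ρ₁₂₀, ρ₁₂₀)),
   ((1, (2, 0, 1), (2, 0, 0)), (2, 1, 1, ρ₁₂₀)),
   ((1, (2, 0, 1), (2, 0, 2)), (2, 1, τ₀₂, ρ₁₂₀)),
   ((1, (2, 0, 2), (2, 0, 0)), (2, 1, τ₁₂, ρ₁₂₀)),
   ((1, (2, 0, 2), (2, 0, 1)), (2, 1, ρ₂₀₁, ρ₁₂₀)),
   ((1, (2, 1, 0), (2, 1, 1)), (2, τ₀₁, τ₀₁, ρ₁₂₀)),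
   ((1, (2, 1, 0), (2, 1, 2)), (2, τ₀₁, ρ₁₂₀, ρ₁₂₀)),
   ((1, (2, 1, 1), (2, 1, 0)), (2, τ₀₁, 1, ρ₁₂₀)),
   ((1, (2, 1, 1), (2, 1, 2)), (2, τ₀₁, τ₀₂, ρ₁₂₀)),
   ((1, (2, 1, 2), (2, 1, 0)), (2, τ₀₁, τ₁₂, ρ₁₂₀)),
   ((1, (2, 1, 2), (2, 1, 1)), (2, τ₀₁, ρ₂₀₁, ρ₁₂₀)),
   ((1, (2, 2, 0), (2, 2, 1)), (2, ρ₁₂₀, τ₀₁, ρ₁₂₀)),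
   ((1, (2, 2, 0), (2, 2, 2)), (2, ρ₁₂₀, ρ₁₂₀, ρ₁₂₀)),
   ((1, (2, 2, 1), (2, 2, 0)), (2, ρ₁₂₀, 1, ρ₁₂₀)),
   ((1, (2, 2, 1), (2, 2, 2)), (2, ρ₁₂₀, τ₀₂, ρ₁₂₀)),
   ((1, (2, 2, 2), (2, 2, 0)), (2, ρ₁₂₀, τ₁₂, ρ₁₂₀)),
   ((1, (2, 2, 2), (2, 2, 1)), (2, ρ₁₂₀, ρ₂₀₁, ρ₁₂₀))]

/-- The witnesses for `⟨3,3,3⟩`, shared factor in slot `3` (`54` candidates): the number of cyclic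
shifts and the permutation sandwich `(π, σ, ρ)` carrying `N₀` to the candidate (found by a search of ours;
checked by the kernel below). [cite: KauersMoosbauer2022FlipGraphs, §4 ((3,3,3): "only one neighbor")] -/
def witTab₃_2 : List ((Fin 3 × Idx 3 × Idx 3) × Wit 3) :=
  [((2, (0, 0, 0), (1, 0, 0)), (1, 1, τ₀₁, 1)),
   ((2, (0, 0, 0), (2, 0, 0)), (1, 1, ρ₁₂₀, 1)),
   ((2, (0, 0, 1), (1, 0, 1)), (1, τ₀₁, τ₀₁, 1)),
   ((2, (0, 0, 1), (2, 0, 1)), (1, τ₀₁, ρ₁₂₀, 1)),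
   ((2, (0, 0, 2), (1, 0, 2)), (1, ρ₁₂₀, τ₀₁, 1)),
   ((2, (0, 0, 2), (2, 0, 2)), (1, ρ₁₂₀, ρ₁₂₀, 1)),
   ((2, (0, 1, 0), (1, 1, 0)), (1, 1, τ₀₁, τ₀₁)),
   ((2, (0, 1, 0), (2, 1, 0)), (1, 1, ρ₁₂₀, τ₀₁)),
   ((2, (0, 1, 1), (1, 1, 1)), (1, τ₀₁, τ₀₁, τ₀₁)),
   ((2, (0, 1, 1), (2, 1, 1)), (1, τ₀₁, ρ₁₂₀, τ₀₁)),
   ((2, (0, 1, 2), (1, 1, 2)), (1, ρ₁₂₀, τ₀₁, τ₀₁)),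
   ((2, (0, 1, 2), (2, 1, 2)), (1, ρ₁₂₀, ρ₁₂₀, τ₀₁)),
   ((2, (0, 2, 0), (1, 2, 0)), (1, 1, τ₀₁, ρ₁₂₀)),
   ((2, (0, 2, 0), (2, 2, 0)), (1, 1, ρ₁₂₀, ρ₁₂₀)),
   ((2, (0, 2, 1), (1, 2, 1)), (1, τ₀₁, τ₀₁, ρ₁₂₀)),
   ((2, (0, 2, 1), (2, 2, 1)), (1, τ₀₁, ρ₁₂₀, ρ₁₂₀)),
   ((2, (0, 2, 2), (1, 2, 2)), (1, ρ₁₂₀, τ₀₁, ρ₁₂₀)),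
   ((2, (0, 2, 2), (2, 2, 2)), (1, ρ₁₂₀, ρ₁₂₀, ρ₁₂₀)),
   ((2, (1, 0, 0), (0, 0, 0)), (1, 1, 1, 1)),
   ((2, (1, 0, 0), (2, 0, 0)), (1, 1, τ₀₂, 1)),
   ((2, (1, 0, 1), (0, 0, 1)), (1, τ₀₁, 1, 1)),
   ((2, (1, 0, 1), (2, 0, 1)), (1, τ₀₁, τ₀₂, 1)),
   ((2, (1, 0, 2), (0, 0, 2)), (1, ρ₁₂₀, 1, 1)),
   ((2, (1, 0, 2), (2, 0, 2)), (1, ρ₁₂₀, τ₀₂, 1)),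
   ((2, (1, 1, 0), (0, 1, 0)), (1, 1, 1, τ₀₁)),
   ((2, (1, 1, 0), (2, 1, 0)), (1, 1, τ₀₂, τ₀₁)),
   ((2, (1, 1, 1), (0, 1, 1)), (1, τ₀₁, 1, τ₀₁)),
   ((2, (1, 1, 1), (2, 1, 1)), (1, τ₀₁, τ₀₂, τ₀₁)),
   ((2, (1, 1, 2), (0, 1, 2)), (1, ρ₁₂₀, 1, τ₀₁)),
   ((2, (1, 1, 2), (2, 1, 2)), (1, ρ₁₂₀, τ₀₂, τ₀₁)),
   ((2, (1, 2, 0), (0, 2, 0)), (1, 1, 1, ρ₁₂₀)),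
   ((2, (1, 2, 0), (2, 2, 0)), (1, 1, τ₀₂, ρ₁₂₀)),
   ((2, (1, 2, 1), (0, 2, 1)), (1, τ₀₁, 1, ρ₁₂₀)),
   ((2, (1, 2, 1), (2, 2, 1)), (1, τ₀₁, τ₀₂, ρ₁₂₀)),
   ((2, (1, 2, 2), (0, 2, 2)), (1, ρ₁₂₀, 1, ρ₁₂₀)),
   ((2, (1, 2, 2), (2, 2, 2)), (1, ρ₁₂₀, τ₀₂, ρ₁₂₀)),
   ((2, (2, 0, 0), (0, 0, 0)), (1, 1, τ₁₂, 1)),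
   ((2, (2, 0, 0), (1, 0, 0)), (1, 1, ρ₂₀₁, 1)),
   ((2, (2, 0, 1), (0, 0, 1)), (1, τ₀₁, τ₁₂, 1)),
   ((2, (2, 0, 1), (1, 0, 1)), (1, τ₀₁, ρ₂₀₁, 1)),
   ((2, (2, 0, 2), (0, 0, 2)), (1, ρ₁₂₀, τ₁₂, 1)),
   ((2, (2, 0, 2), (1, 0, 2)), (1, ρ₁₂₀, ρ₂₀₁, 1)),
   ((2, (2, 1, 0), (0, 1, 0)), (1, 1, τ₁₂, τ₀₁)),
   ((2, (2, 1, 0), (1, 1, 0)), (1, 1, ρ₂₀₁, τ₀₁)),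
   ((2, (2, 1, 1), (0, 1, 1)), (1, τ₀₁, τ₁₂, τ₀₁)),
   ((2, (2, 1, 1), (1, 1, 1)), (1, τ₀₁, ρ₂₀₁, τ₀₁)),
   ((2, (2, 1, 2), (0, 1, 2)), (1, ρ₁₂₀, τ₁₂, τ₀₁)),
   ((2, (2, 1, 2), (1, 1, 2)), (1, ρ₁₂₀, ρ₂₀₁, τ₀₁)),
   ((2, (2, 2, 0), (0, 2, 0)), (1, 1, τ₁₂, ρ₁₂₀)),
   ((2, (2, 2, 0), (1, 2, 0)), (1, 1, ρ₂₀₁, ρ₁₂₀)),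
   ((2, (2, 2, 1), (0, 2, 1)), (1, τ₀₁, τ₁₂, ρ₁₂₀)),
   ((2, (2, 2, 1), (1, 2, 1)), (1, τ₀₁, ρ₂₀₁, ρ₁₂₀)),
   ((2, (2, 2, 2), (0, 2, 2)), (1, ρ₁₂₀, τ₁₂, ρ₁₂₀)),
   ((2, (2, 2, 2), (1, 2, 2)), (1, ρ₁₂₀, ρ₂₀₁, ρ₁₂₀))]

/-- The witness map for `⟨3,3,3⟩` (table lookup). [cite: KauersMoosbauer2022FlipGraphs, §4] -/
def wit₃ (c : Fin 3 × Idx 3 × Idx 3) : Wit 3 :=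
  ((witTab₃_0 ++ witTab₃_1 ++ witTab₃_2).lookup c).getD (0, 1, 1, 1)

set_option synthInstance.maxSize 8192 in
set_option maxHeartbeats 0 in
/-- The heart of `checks₃`, slot `1` (`Z` shared): each valid candidate has the factor triples of
the image of `N₀` under its witness (kernel evaluation, `54` candidates).
[cite: KauersMoosbauer2022FlipGraphs, §4 ((3,3,3): "only one neighbor")] -/
theorem key₃_0 : ∀ i j : Idx 3, i ≠ j → Shared 3 (0, i, j) →
    ∀ s, trip 3 (candFam 3 (0, i, j)) (idxEquiv 3 (wit₃ (0, i, j)) s) =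
      actF 3 (wit₃ (0, i, j)) (trip 3 (candFam 3 (c₀ 3)) s) := by
  decide +kernel

set_option synthInstance.maxSize 8192 in
set_option maxHeartbeats 0 in
/-- The heart of `checks₃`, slot `2` (`X` shared; `54` candidates).
[cite: KauersMoosbauer2022FlipGraphs, §4 ((3,3,3): "only one neighbor")] -/
theorem key₃_1 : ∀ i j : Idx 3, i ≠ j → Shared 3 (1, i, j) →
    ∀ s, trip 3 (candFam 3 (1, i, j)) (idxEquiv 3 (wit₃ (1, i, j)) s) =
      actF 3 (wit₃ (1, i, j)) (trip 3 (candFam 3 (c₀ 3)) s) := by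
  decide +kernel

set_option synthInstance.maxSize 8192 in
set_option maxHeartbeats 0 in
/-- The heart of `checks₃`, slot `3` (`Y` shared; `54` candidates).
[cite: KauersMoosbauer2022FlipGraphs, §4 ((3,3,3): "only one neighbor")] -/
theorem key₃_2 : ∀ i j : Idx 3, i ≠ j → Shared 3 (2, i, j) →
    ∀ s, trip 3 (candFam 3 (2, i, j)) (idxEquiv 3 (wit₃ (2, i, j)) s) =
      actF 3 (wit₃ (2, i, j)) (trip 3 (candFam 3 (c₀ 3)) s) := by
  decide +kernel

set_option synthInstance.maxSize 8192 in
set_option maxHeartbeats 0 in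
/-- **The checks for `⟨3,3,3⟩` over `ℤ₂`** (kernel evaluation; `162` valid candidates).
[cite: KauersMoosbauer2022FlipGraphs, §4 ((3,3,3): "the standard algorithm itself has only one neighbor")] -/
theorem checks₃ : Checks (n := 3) wit₃ where
  ne := by decide +kernel
  inj := by decide +kernel
  sep_wu := by decide +kernel
  sep_wv := by decide +kernel
  sep_uw := by decide +kernel
  sep_uv := by decide +kernel
  sep_vw := by decide +kernel
  sep_vu := by decide +kernel
  c₀_ne := by decide +kernel
  c₀_shared := by decide +kernel
  N₀_ne := by decide +kernel
  key := by
    rintro ⟨s, i, j⟩ hij hsh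
    fin_cases s
    · exact key₃_0 i j hij hsh
    · exact key₃_1 i j hij hsh
    · exact key₃_2 i j hij hsh

set_option synthInstance.maxSize 8192 in
/-- The standard algorithm of `⟨2,2,2⟩` has no lonely factor; `N₀` has one; `N₀`'s members have
pairwise distinct factor triples (kernel evaluation). [cite: KauersMoosbauer2022FlipGraphs, §4] -/
theorem lonelyFacts₂ : ¬ LonelyFam (sW 2) (sU 2) (sV 2) ∧
    LonelyFam (candFam 2 (c₀ 2)).1 (candFam 2 (c₀ 2)).2.1 (candFam 2 (c₀ 2)).2.2 ∧
    (∀ s s', (candFam 2 (c₀ 2)).1 s = (candFam 2 (c₀ 2)).1 s' →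
      (candFam 2 (c₀ 2)).2.1 s = (candFam 2 (c₀ 2)).2.1 s' →
      (candFam 2 (c₀ 2)).2.2 s = (candFam 2 (c₀ 2)).2.2 s' → s = s') := by
  refine ⟨by decide +kernel, by decide +kernel, by decide +kernel⟩

set_option synthInstance.maxSize 8192 in
set_option maxHeartbeats 0 in
/-- The same three facts for `⟨3,3,3⟩` (kernel evaluation). [cite: KauersMoosbauer2022FlipGraphs, §4] -/
theorem lonelyFacts₃ : ¬ LonelyFam (sW 3) (sU 3) (sV 3) ∧
    LonelyFam (candFam 3 (c₀ 3)).1 (candFam 3 (c₀ 3)).2.1 (candFam 3 (c₀ 3)).2.2 ∧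
    (∀ s s', (candFam 3 (c₀ 3)).1 s = (candFam 3 (c₀ 3)).1 s' →
      (candFam 3 (c₀ 3)).2.1 s = (candFam 3 (c₀ 3)).2.1 s' →
      (candFam 3 (c₀ 3)).2.2 s = (candFam 3 (c₀ 3)).2.2 s' → s = s') := by
  refine ⟨by decide +kernel, by decide +kernel, by decide +kernel⟩

end StdNeighbourZ2

open FlipGraph StdNeighbourZ2 in
/-- **KM §4, `(2,2,2)` over `ℤ₂`: "Although the standard algorithm allows many flips, it only has
one neighbor, because any two schemes obtained by a flip from the standard algorithm are
equivalent."** Any two neighbours (Def. 8) of the standard algorithm of `⟨2,2,2⟩` over `ℤ₂` lie in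
one orbit of KM's symmetry group. [cite: KauersMoosbauer2022FlipGraphs, §4] -/
theorem kauersMoosbauer2023_std_neighbours_equivalent₂ {y y' : Scheme (matMulTensor (ZMod 2) 2 2 2)}
    (h : Adj (stdScheme (matMulTensor (ZMod 2) 2 2 2)) y)
    (h' : Adj (stdScheme (matMulTensor (ZMod 2) 2 2 2)) y') : (orbitSetoidKM (ZMod 2) 2).r y y' :=
  std_neighbours_equivalent checks₂ h h'

open FlipGraph StdNeighbourZ2 in
/-- **KM §4, `(2,2,2)` over `ℤ₂`, in the flip graph on orbits (Def. 8):** the orbit of the standard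
algorithm has exactly one out-neighbour, the orbit of `N₀`. [cite: KauersMoosbauer2022FlipGraphs, §4, Def. 8] -/
theorem kauersMoosbauer2023_std_one_neighbour₂ (q : Quotient (orbitSetoidKM (ZMod 2) 2)) :
    flipGraphKM (ZMod 2) 2 (Quotient.mk _ (stdScheme (matMulTensor (ZMod 2) 2 2 2))) q ↔
      q = Quotient.mk _ (N₀ checks₂) :=
  std_one_neighbour checks₂ q

open FlipGraph StdNeighbourZ2 in
/-- **… and that neighbour is not the standard algorithm's own orbit** (`(2,2,2)`, `ℤ₂`).
[cite: KauersMoosbauer2022FlipGraphs, §4, Def. 8] -/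
theorem kauersMoosbauer2023_std_neighbour_ne₂ :
    (Quotient.mk (orbitSetoidKM (ZMod 2) 2) (N₀ checks₂)) ≠
      Quotient.mk _ (stdScheme (matMulTensor (ZMod 2) 2 2 2)) :=
  N₀_orbit_ne_std checks₂ lonelyFacts₂.1 lonelyFacts₂.2.1 lonelyFacts₂.2.2

open FlipGraph StdNeighbourZ2 in
/-- **KM §4, `(3,3,3)` over `ℤ₂`: "Again, and for the same reason as before, the standard algorithm
itself has only one neighbor."** Any two neighbours (Def. 8) of the standard algorithm of `⟨3,3,3⟩`
over `ℤ₂` lie in one orbit of KM's symmetry group. [cite: KauersMoosbauer2022FlipGraphs, §4] -/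
theorem kauersMoosbauer2023_std_neighbours_equivalent₃ {y y' : Scheme (matMulTensor (ZMod 2) 3 3 3)}
    (h : Adj (stdScheme (matMulTensor (ZMod 2) 3 3 3)) y)
    (h' : Adj (stdScheme (matMulTensor (ZMod 2) 3 3 3)) y') : (orbitSetoidKM (ZMod 2) 3).r y y' :=
  std_neighbours_equivalent checks₃ h h'

open FlipGraph StdNeighbourZ2 in
/-- **KM §4, `(3,3,3)` over `ℤ₂`, in the flip graph on orbits (Def. 8):** the orbit of the standard
algorithm has exactly one out-neighbour, the orbit of `N₀`. [cite: KauersMoosbauer2022FlipGraphs, §4, Def. 8] -/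
theorem kauersMoosbauer2023_std_one_neighbour₃ (q : Quotient (orbitSetoidKM (ZMod 2) 3)) :
    flipGraphKM (ZMod 2) 3 (Quotient.mk _ (stdScheme (matMulTensor (ZMod 2) 3 3 3))) q ↔
      q = Quotient.mk _ (N₀ checks₃) :=
  std_one_neighbour checks₃ q

open FlipGraph StdNeighbourZ2 in
/-- **… and that neighbour is not the standard algorithm's own orbit** (`(3,3,3)`, `ℤ₂`).
[cite: KauersMoosbauer2022FlipGraphs, §4, Def. 8] -/
theorem kauersMoosbauer2023_std_neighbour_ne₃ :
    (Quotient.mk (orbitSetoidKM (ZMod 2) 3) (N₀ checks₃)) ≠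
      Quotient.mk _ (stdScheme (matMulTensor (ZMod 2) 3 3 3)) :=
  N₀_orbit_ne_std checks₃ lonelyFacts₃.1 lonelyFacts₃.2.1 lonelyFacts₃.2.2

end Literature.Computability.AlgebraicComplexity
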